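import Literature.Barriers.AtomisticToContinuum.DisorderedHarmonicChainPhasesProofs
import Mathlib.MeasureTheory.Integral.Bochner.ContinuousLinearMap
import Mathlib.MeasureTheory.Constructions.Pi
import Mathlib.MeasureTheory.Integral.Prod
import HarnessLib

/-!
# Ajanki–Huveneers 2011, §5: the operators `T`, `T_y`, `S_{y,n}`, `R_y` and the lemmas behind Prop. 5.1

Fifth file of the Casher–Lebowitz / Ajanki–Huveneers cluster; provefact unit for the named fact
`AjankiHuveneers2011_potentialTheory` (Prop. 5.1 of O. Ajanki, F. Huveneers, CMP **301** (2011)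
841–883, arXiv:1003.1076), vendored in `DisorderedHarmonicChainPhases.lean`. SIZE XL: §5 is a
perturbative potential theory for the non-reversible, non-uniformly-diffusive phase chain `X`,
resting on four lemmas (5.2–5.5) and a Fourier-analytic appendix (7.3). This file DEFINES the
objects of §5 exactly as printed, PROVES their elementary algebra, and vendors Lemmas 5.2–5.5 as
named facts to be discharged bottom-up; the assembly of Prop. 5.1 (Steps 1–3 of its proof) comes
last.

* DEFINED: `T u(x) = 𝔼[(1 + w h(x)B) u(f_B(x))] = ∫ u(f_b(x))(1 + w h(x) b) τ(b) db` (5.3) (`ahT`);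
  its exponential-weight twin `T̃ u(x) = 𝔼[e^{w h(x) B} u(f_B(x))]` (`ahTexp`), whose iterates ARE
  the expectations `𝔼(e^{w∑_{k=1}^n h(X_{k-1})B_k} u(X^x_n))` of Prop. 5.1 (the content of (5.5) is
  `Tⁿ ∼ T̃ⁿ` for `w²n ≤ 1`); `g_b(x,y) = x + ϑ + Φ(y,b)` (5.7) (`ahG`); the convolution operators
  `T_y u(x) = ∫ u(g_b(x,y))(1 + w h(y) b) τ(b) db` (5.6) (`ahTy`); `S_{y,n} = T_{y-nw} ⋯ T_{y-w}`,
  `S_{y,0} = Id` (5.8) (`ahSy`); `R_y = T - T_y` (5.8) (`ahRy`); `‖u‖₁ = ∫_𝕋 |u|` (`ahL1`); the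
  class `L¹_{B(y,r)}(𝕋; ℝ₊)` read on bounded Borel representatives (`AHBallFn`, see below).
* PROVED: measurability/integrability plumbing for the reduced law `τ` (`ReducedLawHyp.measurable`,
  `….integrable_mul`, `b₋ ≤ 0 ≤ b₊`), `1`-periodicity of `Φ`, `f_b`, `T u`, `T_y u`, `S_{y,n} u`,
  "`T1 = 1`" and "`T_y 1 = 1`" (from `𝔼 B = 0`), positivity of `T`, `T̃`, `T_y`.
* PROVED: **Lemma 5.5, eq. (5.19)** — localisation of the supports of `Tⁿu`, `T̃ⁿu`, `S_{y,n}u`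
  for `u` supported in a ball `B(y, Kw)` of `𝕋` (`ahT_iterate_support`, `ahTexp_iterate_support`,
  `ahSy_support`), from Cor. 3.4 (i) (`AjankiHuveneers2011_phaseMonotone_holds`) packaged as
  `K₁w ≤ f_b(x) - x ≤ K₂w` (`ahStep_increment_linear`).
* PROVED: the reduction "First, by (5.5), it is enough to show the proposition with `𝔼_x(…)`
  replaced by `Tⁿu(x)`": the expectation of Prop. 5.1 IS `T̃ⁿu(x)` for bounded Borel `u`, `h`
  (`ahTexp_iterate_eq_integral`, Markov property + Fubini over `τ ⊗ τ^{⊗n}`; finiteness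
  `integrable_ahObs`), and **(5.5)** in the quantitative form `Tⁿu ≤ T̃ⁿu ≤ e^{2(wHb_*)²n} Tⁿu` for
  `u ≥ 0`, `|h| ≤ H`, `wHb_* ≤ 1/2` (`ahT_iterate_sandwich`, from `1 + t ≤ e^t ≤ (1+t)e^{2t²}`),
  with the positivity/monotonicity/boundedness/measurability of `T`, `T̃`, `T_y` on bounded Borel
  functions that this requires (`ahT_mono`, `ahTexp_mono`, `ahTy_mono`, `abs_ahT_le`,
  `measurable_ahT`, `ahT_iterate_closure`, …).
* NAMED FACTS: Lemma 5.2 = (5.9)–(5.10) (`AjankiHuveneers2011_approxKernels`) and (5.11)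
  (`…_approxKernelsLower`); Lemma 5.4 (5.14)–(5.15) (`…_RyL1Estimate`); Lemma 5.5 (5.20)
  (`…_concentration`). Lemma 5.3 (5.12) (`…_RyEstimate`) is NOT a fact of this file any more: it is
  REFUTED as printed and kept only as a `@[deprecated]` record (see `## Verdicts` below and its
  docstring); the corrected lemma lives, proved, in `DisorderedHarmonicChainRyEstimate.lean`.

## Reading conventions (faithfulness notes)

* `𝕋 = ℝ/ℤ`; functions on `𝕋` are `1`-periodic functions on `ℝ` (paper, §2 "Periodicity"), the
  chain is the lift `ahPhase`; `|x|_𝕋 = dist(x, ℤ)`, so "`|y|_𝕋 ≥ ε`" is `∀ k : ℤ, ε ≤ |y - k|` and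
  "`x ∈ B(y,r)`" is `∃ k : ℤ, |x - y - k| < r`; `‖u‖₁ = ∫_{[0,1)} |u|`.
* `u ∈ L¹_A(𝕋; ℝ₊)`. The lemmas of §5 make POINTWISE claims ("for every `x ∈ 𝕋`") about `Tⁿu`,
  `S_{y,n}u`, which for an a.e.-class are only meaningful through a representative (`T u(x) = u(x+ϑ)`
  for `x ∈ ℤ` depends on the point value). We read them for Borel, bounded, non-negative
  representatives vanishing off `A` (`AHBallFn`): this is the generality in which the proof of
  Prop. 5.1 invokes them — `Tⁿ` is positive and linear, so Prop. 5.1 reduces first to bounded Borel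
  `u` (truncation and monotone convergence; a.e.-modifications are invisible once the law of `X^x_n`
  is absolutely continuous, which the upper bound itself yields) and then to `u` supported in a
  ball `B(y, w²)` ("Second" observation of the proof). A restriction of the printed hypotheses,
  never a strengthening of a conclusion.
* Constants: "(A2) `w ∈ ]0,w₀]`, where `w₀` is small enough to make all our assertions valid. All
  the constants introduced below may depend on `κ` and `h`" (and on the law `τ`). Each fact below
  therefore quantifies `∃ w₀ > 0, ∃ K, ∀ w ∈ (0, w₀]` after `τ`, `h` and the lemma's own parameters
  (`ε`, `K`, `R`) are fixed, and before `y`, `u`, `n`, `x`.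
* `‖·‖_∞` bounds in (5.12) are rendered by arbitrary majorants `A` of the four sup-norms involved
  (equivalent, and avoids `iSup` of possibly unbounded functions).

## Verdicts

* `AjankiHuveneers2011_RyEstimate` (Lemma 5.3, eq. (5.12)) is FALSE as printed (2026-08-15): its
  negation `AjankiHuveneers2011_RyEstimate_false` is proved in
  `DisorderedHarmonicChainRyCounterexample.lean`; the corrected statement (`|sin π(· - y - w)|`
  instead of `sin² π(· - y - w)` on the `u''` sup-norm, everything else verbatim) is
  `AjankiHuveneers2011_RyEstimateCorrected`, PROVED in `DisorderedHarmonicChainRyEstimate.lean`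
  (`AjankiHuveneers2011_RyEstimateCorrected_holds`). **Verdict clean-up (2026-08-16): RESTATED.**
  The corrected statement is the restatement; it is not re-declared in this file because the file
  that declares and proves it imports this one (a second declaration of the same name would not
  build), and for the same reason the old def carries `@[deprecated "…"]` with a message naming
  the refutation and the replacement rather than `@[deprecated <NewName>]`. The old def is kept,
  statement byte-for-byte, only because its refutation names it; it is no longer a named fact of
  the tree (no `…_holds` can exist); never thread `(h : AjankiHuveneers2011_RyEstimate)` — it
  yields `False`. Its two remaining users (`…_RyEstimate_false`, `…_RyEstimate.corrected`) switch
  `linter.deprecated` off for themselves alone.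

## Sources

O. Ajanki, F. Huveneers, CMP 301 (2011) 841–883, arXiv:1003.1076: §5 eqs. (5.3)–(5.8), Lemma 5.2
(5.9)–(5.11), Lemma 5.3 (5.12), Lemma 5.4 (5.14)–(5.15), Lemma 5.5 (5.19)–(5.20), proof of
Prop. 5.1 (Steps 1–3); Appendix 7.3 (proof of Lemma 5.2).
-/

noncomputable section

open MeasureTheory Finset Real

namespace Literature.Barriers.AtomisticToContinuum.HeatConduction

/-! ### The reduced law: measurability and integrability plumbing -/

namespace ReducedLawHyp

variable {τ : ℝ → ℝ} {bm bp : ℝ}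

/-- `τ` is its own restriction to `[b₋, b₊]` extended by `0`. [cite: AjankiHuveneers2011, §2 ¶1] -/
theorem eq_piecewise (hτ : ReducedLawHyp τ bm bp) [∀ s, Decidable (s ∈ Set.Icc bm bp)] :
    τ = (Set.Icc bm bp).piecewise τ 0 := by
  funext s
  by_cases hs : s ∈ Set.Icc bm bp
  · rw [Set.piecewise_eq_of_mem _ _ _ hs]
  · rw [Set.piecewise_eq_of_notMem _ _ _ hs]
    exact hτ.eq_zero s hs

/-- `τ` is Borel measurable. [folklore] -/
theorem measurable (hτ : ReducedLawHyp τ bm bp) : Measurable τ := by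
  classical
  rw [hτ.eq_piecewise]
  exact hτ.continuousOn.measurable_piecewise continuousOn_const measurableSet_Icc

/-- `τ` is bounded. [folklore] -/
theorem exists_bound (hτ : ReducedLawHyp τ bm bp) : ∃ C : ℝ, 0 ≤ C ∧ ∀ s, |τ s| ≤ C := by
  obtain ⟨C, hC⟩ := isCompact_Icc.exists_bound_of_continuousOn hτ.continuousOn
  refine ⟨max C 0, le_max_right _ _, fun s => ?_⟩
  by_cases hs : s ∈ Set.Icc bm bp
  · exact ((Real.norm_eq_abs _).symm.le.trans (hC s hs)).trans (le_max_left _ _)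
  · rw [hτ.eq_zero s hs, abs_zero]
    exact le_max_right _ _

/-- `τ` is integrable. [folklore] -/
theorem integrable (hτ : ReducedLawHyp τ bm bp) : Integrable τ := by
  have h1 : IntegrableOn τ (Set.Icc bm bp) := hτ.continuousOn.integrableOn_compact isCompact_Icc
  refine (integrableOn_iff_integrable_of_support_subset (fun s hs => ?_)).mp h1
  by_contra h
  exact hs (hτ.eq_zero s h)

/-- `b ↦ f(b) τ(b)` is integrable as soon as `f` is a.e.-strongly measurable and bounded on
`[b₋, b₊]`. [folklore] -/
theorem integrable_mul (hτ : ReducedLawHyp τ bm bp) {f : ℝ → ℝ} (hf : AEStronglyMeasurable f)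
    {C : ℝ} (hC : ∀ b ∈ Set.Icc bm bp, |f b| ≤ C) : Integrable fun b => f b * τ b := by
  have heq : (fun b => f b * τ b) = fun b => (Set.Icc bm bp).indicator f b * τ b := by
    funext b
    by_cases hb : b ∈ Set.Icc bm bp
    · rw [Set.indicator_of_mem hb]
    · rw [hτ.eq_zero b hb, mul_zero, mul_zero]
  rw [heq]
  refine hτ.integrable.bdd_mul (hf.indicator measurableSet_Icc) (c := max C 0)
    (ae_of_all _ fun b => ?_)
  rw [Real.norm_eq_abs]
  by_cases hb : b ∈ Set.Icc bm bp
  · rw [Set.indicator_of_mem hb]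
    exact (hC b hb).trans (le_max_left _ _)
  · rw [Set.indicator_of_notMem hb, abs_zero]
    exact le_max_right _ _

/-- On the support, `|b| ≤ b_* := max(|b₋|, |b₊|)`. [folklore] -/
theorem abs_le_of_mem {b : ℝ} (hb : b ∈ Set.Icc bm bp) : |b| ≤ max |bm| |bp| := by
  rcases le_or_gt 0 b with h | h
  · rw [abs_of_nonneg h]
    exact (hb.2.trans (le_abs_self _)).trans (le_max_right _ _)
  · rw [abs_of_neg h]
    exact ((neg_le_neg hb.1).trans (neg_le_abs _)).trans (le_max_left _ _)

/-- `b ↦ b τ(b)` is integrable. [folklore] -/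
theorem integrable_id_mul (hτ : ReducedLawHyp τ bm bp) : Integrable fun b => b * τ b :=
  hτ.integrable_mul measurable_id.aestronglyMeasurable fun _ hb => abs_le_of_mem hb

/-- `∫ (c₀ + c₁ b) τ(b) db = c₀`: total mass one and zero mean. [cite: AjankiHuveneers2011, §5 after eq. (5.3)] -/
theorem integral_affine (hτ : ReducedLawHyp τ bm bp) (c₀ c₁ : ℝ) :
    ∫ b, (c₀ + c₁ * b) * τ b = c₀ := by
  have : (fun b => (c₀ + c₁ * b) * τ b) = fun b => c₀ * τ b + c₁ * (b * τ b) := by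
    funext b; ring
  rw [this, integral_add (hτ.integrable.const_mul _) (hτ.integrable_id_mul.const_mul _),
    integral_const_mul, integral_const_mul, hτ.integral_eq_one, hτ.mean_zero]
  ring

/-- Zero mean forces `b₋ ≤ 0`. [cite: AjankiHuveneers2011, §2 ¶1] -/
theorem bm_nonpos (hτ : ReducedLawHyp τ bm bp) : bm ≤ 0 := by
  have h1 : 0 ≤ ∫ b, (-bm + 1 * b) * τ b := by
    refine integral_nonneg fun b => ?_
    by_cases hb : b ∈ Set.Icc bm bp
    · exact mul_nonneg (by linarith [hb.1]) (hτ.nonneg b)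
    · rw [hτ.eq_zero b hb, mul_zero]
      exact le_rfl
  rw [hτ.integral_affine] at h1
  linarith

/-- Zero mean forces `0 ≤ b₊`. [cite: AjankiHuveneers2011, §2 ¶1] -/
theorem bp_nonneg (hτ : ReducedLawHyp τ bm bp) : 0 ≤ bp := by
  have h1 : 0 ≤ ∫ b, (bp + (-1) * b) * τ b := by
    refine integral_nonneg fun b => ?_
    by_cases hb : b ∈ Set.Icc bm bp
    · exact mul_nonneg (by linarith [hb.2]) (hτ.nonneg b)
    · rw [hτ.eq_zero b hb, mul_zero]
      exact le_rfl
  rw [hτ.integral_affine] at h1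
  linarith

end ReducedLawHyp

/-! ### Periodicity and measurability of `Φ` and `f_b` -/

/-- `Φ(x + 1, b) = Φ(x, b)`. [cite: AjankiHuveneers2011, Lemma 3.2 eq. (3.10)] -/
theorem ahPhi_add_one (w x b : ℝ) : ahPhi w (x + 1) b = ahPhi w x b := by
  have h2 : 2 * π * (x + 1) = 2 * π * x + 2 * π := by ring
  unfold ahPhi ahNum ahDen
  rw [h2, Real.cos_add_two_pi, Real.sin_add_two_pi]

/-- `x ↦ Φ(x, b)` is `1`-periodic. [cite: AjankiHuveneers2011, Lemma 3.2 eq. (3.10)] -/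
theorem ahPhi_periodic (w b : ℝ) : Function.Periodic (fun x => ahPhi w x b) 1 := fun x =>
  ahPhi_add_one w x b

/-- `Φ(x + k, b) = Φ(x, b)` for `k ∈ ℤ`. [cite: AjankiHuveneers2011, Lemma 3.2 eq. (3.10)] -/
theorem ahPhi_add_int (w x b : ℝ) (k : ℤ) : ahPhi w (x + k) b = ahPhi w x b := by
  simpa using (ahPhi_periodic w b).int_mul k x

/-- `f_b(x + 1) = f_b(x) + 1`: `f_b` is the lift of a circle map. [cite: AjankiHuveneers2011, Lemma 3.2 eq. (3.8)] -/
theorem ahStep_add_one (w b x : ℝ) : ahStep w b (x + 1) = ahStep w b x + 1 := by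
  unfold ahStep
  rw [ahPhi_add_one]
  ring

/-- `f_b(x + k) = f_b(x) + k` for `k ∈ ℤ`. [cite: AjankiHuveneers2011, Lemma 3.2 eq. (3.8)] -/
theorem ahStep_add_int (w b x : ℝ) (k : ℤ) : ahStep w b (x + k) = ahStep w b x + k := by
  unfold ahStep
  rw [ahPhi_add_int]
  ring

/-- `(x, b) ↦ Φ(x, b)` is Borel measurable. [folklore] -/
theorem measurable_ahPhi₂ (w : ℝ) : Measurable fun p : ℝ × ℝ => ahPhi w p.1 p.2 := by
  have hN : Continuous fun p : ℝ × ℝ => ahNum w p.1 p.2 := by unfold ahNum; fun_prop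
  have hD : Continuous fun p : ℝ × ℝ => ahDen w p.1 p.2 := by unfold ahDen; fun_prop
  have hq : Measurable fun p : ℝ × ℝ => ahNum w p.1 p.2 / ahDen w p.1 p.2 :=
    hN.measurable.div hD.measurable
  unfold ahPhi
  exact (Real.continuous_arctan.measurable.comp hq).div_const π

/-- `b ↦ Φ(x, b)` is Borel measurable. [folklore] -/
theorem measurable_ahPhi_right (w x : ℝ) : Measurable fun b : ℝ => ahPhi w x b := by
  have hx : Measurable fun b : ℝ => (x, b) := measurable_const.prodMk measurable_id
  have : (fun b => ahPhi w x b) = (fun p : ℝ × ℝ => ahPhi w p.1 p.2) ∘ fun b => (x, b) := rfl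
  rw [this]
  exact (measurable_ahPhi₂ w).comp hx

/-- `(x, b) ↦ f_b(x)` is Borel measurable. [folklore] -/
theorem measurable_ahStep₂ (w : ℝ) : Measurable fun p : ℝ × ℝ => ahStep w p.2 p.1 := by
  have : (fun p : ℝ × ℝ => ahStep w p.2 p.1) =
      fun p : ℝ × ℝ => p.1 + ahTheta w + ahPhi w p.1 p.2 := rfl
  rw [this]
  exact (measurable_fst.add_const _).add (measurable_ahPhi₂ w)

/-- `b ↦ f_b(x)` is Borel measurable. [folklore] -/
theorem measurable_ahStep_right (w x : ℝ) : Measurable fun b : ℝ => ahStep w b x := by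
  have hx : Measurable fun b : ℝ => (x, b) := measurable_const.prodMk measurable_id
  have : (fun b => ahStep w b x) = (fun p : ℝ × ℝ => ahStep w p.2 p.1) ∘ fun b => (x, b) := rfl
  rw [this]
  exact (measurable_ahStep₂ w).comp hx

/-! ### The operators of §5 -/

/-- **The operator `T`** (5.3): `T u(x) := 𝔼[(1 + w h(x) B) u ∘ f_B(x)]
= ∫_{b₋}^{b₊} u ∘ f_b(x) (1 + w h(x) b) τ(b) db` — "formally, the transition operator of some
Markov chain on the circle" (`T1 = 1` since `𝔼 B = 0`). Here `u, h : ℝ → ℝ` are `1`-periodic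
(functions on `𝕋`), `f_b = ahStep w b` is the lifted one-step map, `τ` the reduced density.
[cite: AjankiHuveneers2011, §5 eq. (5.3)] -/
def ahT (τ : ℝ → ℝ) (w : ℝ) (h : ℝ → ℝ) (u : ℝ → ℝ) (x : ℝ) : ℝ :=
  ∫ b, u (ahStep w b x) * ((1 + w * h x * b) * τ b)

/-- The exponential-weight transition operator `T̃ u(x) := 𝔼[e^{w h(x) B} u ∘ f_B(x)]
= ∫ u ∘ f_b(x) e^{w h(x) b} τ(b) db`, whose `n`-th iterate at `x` is exactly the expectation
`𝔼(e^{w ∑_{k=1}^n h(X^x_{k-1}) B_k} u(X^x_n))` of Prop. 5.1; (5.5) compares it with `Tⁿ` through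
`e^{w h(x) b} = (1 + w h(x) b) e^{𝒪(w²)}`. [cite: AjankiHuveneers2011, §5 eqs. (5.4)-(5.5)] -/
def ahTexp (τ : ℝ → ℝ) (w : ℝ) (h : ℝ → ℝ) (u : ℝ → ℝ) (x : ℝ) : ℝ :=
  ∫ b, u (ahStep w b x) * (Real.exp (w * h x * b) * τ b)

/-- `g_b(x, y) := x + ϑ + Φ(y, b)` (`= x + w + wφ(y)b + w²ψ(y)b² + 𝒪(w³)`): the step with the phase
correction frozen at `y`. [cite: AjankiHuveneers2011, §5 eq. (5.7)] -/
def ahG (w b x y : ℝ) : ℝ := x + ahTheta w + ahPhi w y b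

/-- **The convolution operator `T_y`** (5.6): `T_y u(x) := ∫ u ∘ g_b(x, y) (1 + w h(y) b) τ(b) db`.
[cite: AjankiHuveneers2011, §5 eq. (5.6)] -/
def ahTy (τ : ℝ → ℝ) (w : ℝ) (h : ℝ → ℝ) (y : ℝ) (u : ℝ → ℝ) (x : ℝ) : ℝ :=
  ∫ b, u (ahG w b x y) * ((1 + w * h y * b) * τ b)

/-- **`S_{y,n} := T_{y-nw} ⋯ T_{y-w}`**, `S_{y,0} := Id` (so `S_{y,n+1} = T_{y-(n+1)w} S_{y,n}`).
[cite: AjankiHuveneers2011, §5 eq. (5.8)] -/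
def ahSy (τ : ℝ → ℝ) (w : ℝ) (h : ℝ → ℝ) (y : ℝ) : ℕ → (ℝ → ℝ) → ℝ → ℝ
  | 0 => fun u => u
  | n + 1 => fun u => ahTy τ w h (y - (n + 1) * w) (ahSy τ w h y n u)

/-- **`R_y := T - T_y`**. [cite: AjankiHuveneers2011, §5 eq. (5.8)] -/
def ahRy (τ : ℝ → ℝ) (w : ℝ) (h : ℝ → ℝ) (y : ℝ) (u : ℝ → ℝ) (x : ℝ) : ℝ :=
  ahT τ w h u x - ahTy τ w h y u x

/-- `‖u‖₁ = ∫_𝕋 |u(y)| dy`, the `L¹(𝕋)`-norm of a `1`-periodic function (one period).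
[cite: AjankiHuveneers2011, §5 (norms `‖·‖_p` on `L^p(𝕋)`)] -/
def ahL1 (u : ℝ → ℝ) : ℝ := ∫ y in Set.Ico (0 : ℝ) 1, |u y|

/-- **`u ∈ L¹_{B(y,r)}(𝕋; ℝ₊)`** ("`L^p_A(𝕋) := {u ∈ L^p(𝕋) : supp(u) ⊂ A}`", `A = B(y, r)` a ball of
`𝕋`), read on a bounded Borel representative: `u : ℝ → ℝ` is `1`-periodic, Borel measurable,
non-negative, bounded, and vanishes at every `x` with `|x - y|_𝕋 ≥ r`. See the module docstring
for why bounded Borel representatives are the right reading of the pointwise lemmas of §5.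
[cite: AjankiHuveneers2011, §5 (display after Prop. 5.1)] -/
structure AHBallFn (u : ℝ → ℝ) (y r : ℝ) : Prop where
  /-- a function on `𝕋` -/
  periodic : Function.Periodic u 1
  /-- a Borel representative -/
  measurable : Measurable u
  /-- values in `ℝ₊` -/
  nonneg : ∀ x, 0 ≤ u x
  /-- bounded representative -/
  bounded : ∃ M : ℝ, ∀ x, u x ≤ M
  /-- `supp u ⊂ B(y, r) ⊂ 𝕋` -/
  support : ∀ x, u x ≠ 0 → ∃ k : ℤ, |x - y - k| < r

/-! ### Elementary algebra of the operators -/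

section Algebra

variable (τ : ℝ → ℝ) (w : ℝ) (h : ℝ → ℝ)

/-- `S_{y,0} = Id`. [cite: AjankiHuveneers2011, §5 eq. (5.8)] -/
@[simp] theorem ahSy_zero (y : ℝ) (u : ℝ → ℝ) : ahSy τ w h y 0 u = u := rfl

/-- `S_{y,n+1} = T_{y-(n+1)w} ∘ S_{y,n}`. [cite: AjankiHuveneers2011, §5 eq. (5.8)] -/
theorem ahSy_succ (y : ℝ) (n : ℕ) (u : ℝ → ℝ) :
    ahSy τ w h y (n + 1) u = ahTy τ w h (y - (n + 1) * w) (ahSy τ w h y n u) := rfl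

/-- `R_y u = T u - T_y u`. [cite: AjankiHuveneers2011, §5 eq. (5.8)] -/
theorem ahRy_apply (y : ℝ) (u : ℝ → ℝ) (x : ℝ) :
    ahRy τ w h y u x = ahT τ w h u x - ahTy τ w h y u x := rfl

/-- `g_b(x + 1, y) = g_b(x, y) + 1`. [cite: AjankiHuveneers2011, §5 eq. (5.7)] -/
theorem ahG_add_one (b x y : ℝ) : ahG w b (x + 1) y = ahG w b x y + 1 := by
  unfold ahG; ring

/-- `g_b(x, y + 1) = g_b(x, y)`. [cite: AjankiHuveneers2011, §5 eq. (5.7)] -/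
theorem ahG_add_one_right (b x y : ℝ) : ahG w b x (y + 1) = ahG w b x y := by
  unfold ahG; rw [ahPhi_add_one]

variable {τ w h}

/-- `T u` is `1`-periodic when `u` and `h` are. [cite: AjankiHuveneers2011, §5 eq. (5.3)] -/
theorem ahT_periodic {u : ℝ → ℝ} (hu : Function.Periodic u 1) (hh : Function.Periodic h 1) :
    Function.Periodic (ahT τ w h u) 1 := by
  intro x
  unfold ahT
  congr 1
  funext b
  rw [ahStep_add_one, hu, hh]

/-- `T̃ u` is `1`-periodic when `u` and `h` are. [cite: AjankiHuveneers2011, §5 eqs. (5.3)-(5.5)] -/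
theorem ahTexp_periodic {u : ℝ → ℝ} (hu : Function.Periodic u 1) (hh : Function.Periodic h 1) :
    Function.Periodic (ahTexp τ w h u) 1 := by
  intro x
  unfold ahTexp
  congr 1
  funext b
  rw [ahStep_add_one, hu, hh]

/-- `T_y u` is `1`-periodic when `u` is. [cite: AjankiHuveneers2011, §5 eq. (5.6)] -/
theorem ahTy_periodic (y : ℝ) {u : ℝ → ℝ} (hu : Function.Periodic u 1) :
    Function.Periodic (ahTy τ w h y u) 1 := by
  intro x
  unfold ahTy
  congr 1
  funext b
  rw [ahG_add_one, hu]

/-- `T_{y+1} = T_y` when `h` is `1`-periodic. [cite: AjankiHuveneers2011, §5 eq. (5.6)] -/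
theorem ahTy_add_one (y : ℝ) (hh : Function.Periodic h 1) (u : ℝ → ℝ) :
    ahTy τ w h (y + 1) u = ahTy τ w h y u := by
  funext x
  unfold ahTy
  congr 1
  funext b
  rw [ahG_add_one_right, hh]

/-- `S_{y,n} u` is `1`-periodic when `u` is. [cite: AjankiHuveneers2011, §5 eq. (5.8)] -/
theorem ahSy_periodic (y : ℝ) {u : ℝ → ℝ} (hu : Function.Periodic u 1) :
    ∀ n, Function.Periodic (ahSy τ w h y n u) 1
  | 0 => hu
  | n + 1 => ahTy_periodic _ (ahSy_periodic y hu n)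

/-- `R_y u` is `1`-periodic when `u` and `h` are. [cite: AjankiHuveneers2011, §5 eq. (5.8)] -/
theorem ahRy_periodic (y : ℝ) {u : ℝ → ℝ} (hu : Function.Periodic u 1)
    (hh : Function.Periodic h 1) : Function.Periodic (ahRy τ w h y u) 1 := by
  intro x
  rw [ahRy_apply, ahRy_apply, ahT_periodic hu hh, ahTy_periodic y hu]

variable {bm bp : ℝ}

/-- **`T1 = 1`** ("since `𝔼(B) = ∫ b τ(b) db = 0`, one has `T1 = 1`").
[cite: AjankiHuveneers2011, §5 after eq. (5.3)] -/
theorem ahT_one (hτ : ReducedLawHyp τ bm bp) (x : ℝ) : ahT τ w h (fun _ => 1) x = 1 := by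
  unfold ahT
  simp only [one_mul]
  have : (fun b => (1 + w * h x * b) * τ b) = fun b => (1 + (w * h x) * b) * τ b := by
    funext b; ring
  rw [this, hτ.integral_affine]

/-- `T_y 1 = 1` likewise. [cite: AjankiHuveneers2011, §5 eq. (5.6) and after (5.3)] -/
theorem ahTy_one (hτ : ReducedLawHyp τ bm bp) (y x : ℝ) : ahTy τ w h y (fun _ => 1) x = 1 := by
  unfold ahTy
  simp only [one_mul]
  have : (fun b => (1 + w * h y * b) * τ b) = fun b => (1 + (w * h y) * b) * τ b := by
    funext b; ring
  rw [this, hτ.integral_affine]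

/-- The weight `1 + w h(x) b` is non-negative on the support of `τ` once `w |h(x)| b_* ≤ 1`.
[cite: AjankiHuveneers2011, §5 after eq. (5.3) (`‖T‖_{∞→∞} = 1`)] -/
theorem ahWeight_nonneg {x b : ℝ} (hw : 0 ≤ w) (hwh : w * |h x| * max |bm| |bp| ≤ 1)
    (hb : b ∈ Set.Icc bm bp) : 0 ≤ 1 + w * h x * b := by
  have h1 : |w * h x * b| ≤ 1 := by
    rw [abs_mul, abs_mul, abs_of_nonneg hw]
    exact (mul_le_mul_of_nonneg_left (ReducedLawHyp.abs_le_of_mem hb) (by positivity)).trans hwh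
  linarith [neg_abs_le (w * h x * b)]

/-- **`T` is positive**: `u ≥ 0 ⟹ T u ≥ 0` (for `w |h(x)| b_* ≤ 1`).
[cite: AjankiHuveneers2011, §5, proof of Prop. 5.1 ("if `u₁ ≥ u₂`, one has `Tu₁ ≥ Tu₂`")] -/
theorem ahT_nonneg (hτ : ReducedLawHyp τ bm bp) {u : ℝ → ℝ} (hu : ∀ z, 0 ≤ u z) (hw : 0 ≤ w)
    {x : ℝ} (hwh : w * |h x| * max |bm| |bp| ≤ 1) : 0 ≤ ahT τ w h u x := by
  refine integral_nonneg fun b => ?_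
  by_cases hb : b ∈ Set.Icc bm bp
  · exact mul_nonneg (hu _) (mul_nonneg (ahWeight_nonneg hw hwh hb) (hτ.nonneg b))
  · simp [hτ.eq_zero b hb]

/-- `T̃` is positive: `u ≥ 0 ⟹ T̃ u ≥ 0`. [cite: AjankiHuveneers2011, §5 eqs. (5.4)-(5.5)] -/
theorem ahTexp_nonneg (hτ : ReducedLawHyp τ bm bp) {u : ℝ → ℝ} (hu : ∀ z, 0 ≤ u z) (x : ℝ) :
    0 ≤ ahTexp τ w h u x :=
  integral_nonneg fun b => mul_nonneg (hu _) (mul_nonneg (Real.exp_pos _).le (hτ.nonneg b))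

/-- `T_y` is positive (for `w |h(y)| b_* ≤ 1`). [cite: AjankiHuveneers2011, §5 eq. (5.6)] -/
theorem ahTy_nonneg (hτ : ReducedLawHyp τ bm bp) {u : ℝ → ℝ} (hu : ∀ z, 0 ≤ u z) (hw : 0 ≤ w)
    {y : ℝ} (hwh : w * |h y| * max |bm| |bp| ≤ 1) (x : ℝ) : 0 ≤ ahTy τ w h y u x := by
  refine integral_nonneg fun b => ?_
  by_cases hb : b ∈ Set.Icc bm bp
  · exact mul_nonneg (hu _) (mul_nonneg (ahWeight_nonneg hw hwh hb) (hτ.nonneg b))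
  · simp [hτ.eq_zero b hb]

end Algebra

/-! ### Lemma 5.5, eq. (5.19): localisation of the supports of `Tⁿu` and `S_{y,n}u` (proved) -/

section Support

variable {τ : ℝ → ℝ} {w : ℝ} {h : ℝ → ℝ} {bm bp : ℝ}

/-- If `T v(x) ≠ 0` then `v(f_b(x)) ≠ 0` for some `b` in the support of `τ`. [folklore] -/
theorem exists_ne_zero_of_ahT_ne_zero (hτ0 : ∀ s ∉ Set.Icc bm bp, τ s = 0) {v : ℝ → ℝ} {x : ℝ}
    (hx : ahT τ w h v x ≠ 0) : ∃ b ∈ Set.Icc bm bp, v (ahStep w b x) ≠ 0 := by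
  by_contra hcon
  push Not at hcon
  apply hx
  unfold ahT
  have : (fun b => v (ahStep w b x) * ((1 + w * h x * b) * τ b)) = fun _ => 0 := by
    funext b
    by_cases hb : b ∈ Set.Icc bm bp
    · rw [hcon b hb, zero_mul]
    · rw [hτ0 b hb, mul_zero, mul_zero]
  rw [this, integral_zero]

/-- If `T̃ v(x) ≠ 0` then `v(f_b(x)) ≠ 0` for some `b` in the support of `τ`. [folklore] -/
theorem exists_ne_zero_of_ahTexp_ne_zero (hτ0 : ∀ s ∉ Set.Icc bm bp, τ s = 0) {v : ℝ → ℝ}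
    {x : ℝ} (hx : ahTexp τ w h v x ≠ 0) : ∃ b ∈ Set.Icc bm bp, v (ahStep w b x) ≠ 0 := by
  by_contra hcon
  push Not at hcon
  apply hx
  unfold ahTexp
  have : (fun b => v (ahStep w b x) * (Real.exp (w * h x * b) * τ b)) = fun _ => 0 := by
    funext b
    by_cases hb : b ∈ Set.Icc bm bp
    · rw [hcon b hb, zero_mul]
    · rw [hτ0 b hb, mul_zero, mul_zero]
  rw [this, integral_zero]

/-- If `T_y v(x) ≠ 0` then `v(g_b(x, y)) ≠ 0` for some `b` in the support of `τ`. [folklore] -/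
theorem exists_ne_zero_of_ahTy_ne_zero (hτ0 : ∀ s ∉ Set.Icc bm bp, τ s = 0) {v : ℝ → ℝ}
    {y x : ℝ} (hx : ahTy τ w h y v x ≠ 0) : ∃ b ∈ Set.Icc bm bp, v (ahG w b x y) ≠ 0 := by
  by_contra hcon
  push Not at hcon
  apply hx
  unfold ahTy
  have : (fun b => v (ahG w b x y) * ((1 + w * h y * b) * τ b)) = fun _ => 0 := by
    funext b
    by_cases hb : b ∈ Set.Icc bm bp
    · rw [hcon b hb, zero_mul]
    · rw [hτ0 b hb, mul_zero, mul_zero]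
  rw [this, integral_zero]

/-- `g_b(x, y) - x = f_b(y) - y` (`= ϑ + Φ(y, b)`). [cite: AjankiHuveneers2011, §5 eq. (5.7)] -/
theorem ahG_sub (w b x y : ℝ) : ahG w b x y - x = ahStep w b y - y := by
  unfold ahG ahStep; ring

/-- Support propagation under `Tⁿ`, given two-sided bounds `K₁w ≤ f_b(x) - x ≤ K₂w` on the
increments: if `u` vanishes unless `x - y ∈ (lo, hi) + ℤ`, then `Tⁿu` vanishes unless
`x - y ∈ (lo - K₂wn, hi - K₁wn) + ℤ`. [cite: AjankiHuveneers2011, Lemma 5.5, proof of (5.19)] -/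
theorem ahT_iterate_support_aux (hτ0 : ∀ s ∉ Set.Icc bm bp, τ s = 0) {K₁ K₂ : ℝ}
    (hinc : ∀ x, ∀ b ∈ Set.Icc bm bp, K₁ * w ≤ ahStep w b x - x ∧ ahStep w b x - x ≤ K₂ * w)
    {u : ℝ → ℝ} {y lo hi : ℝ} (hu : ∀ x, u x ≠ 0 → ∃ k : ℤ, lo < x - y - k ∧ x - y - k < hi) :
    ∀ (n : ℕ) (x : ℝ), (ahT τ w h)^[n] u x ≠ 0 →
      ∃ k : ℤ, lo - K₂ * w * n < x - y - k ∧ x - y - k < hi - K₁ * w * n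
  | 0, x, hx => by simpa using hu x hx
  | n + 1, x, hx => by
    rw [Function.iterate_succ_apply'] at hx
    obtain ⟨b, hb, hne⟩ := exists_ne_zero_of_ahT_ne_zero hτ0 hx
    obtain ⟨k, h1, h2⟩ := ahT_iterate_support_aux hτ0 hinc hu n (ahStep w b x) hne
    obtain ⟨h3, h4⟩ := hinc x b hb
    refine ⟨k, ?_, ?_⟩ <;> push_cast <;> linarith

/-- Support propagation under `T̃ⁿ` (same statement as for `Tⁿ`).
[cite: AjankiHuveneers2011, Lemma 5.5, proof of (5.19)] -/
theorem ahTexp_iterate_support_aux (hτ0 : ∀ s ∉ Set.Icc bm bp, τ s = 0) {K₁ K₂ : ℝ}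
    (hinc : ∀ x, ∀ b ∈ Set.Icc bm bp, K₁ * w ≤ ahStep w b x - x ∧ ahStep w b x - x ≤ K₂ * w)
    {u : ℝ → ℝ} {y lo hi : ℝ} (hu : ∀ x, u x ≠ 0 → ∃ k : ℤ, lo < x - y - k ∧ x - y - k < hi) :
    ∀ (n : ℕ) (x : ℝ), (ahTexp τ w h)^[n] u x ≠ 0 →
      ∃ k : ℤ, lo - K₂ * w * n < x - y - k ∧ x - y - k < hi - K₁ * w * n
  | 0, x, hx => by simpa using hu x hx
  | n + 1, x, hx => by
    rw [Function.iterate_succ_apply'] at hx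
    obtain ⟨b, hb, hne⟩ := exists_ne_zero_of_ahTexp_ne_zero hτ0 hx
    obtain ⟨k, h1, h2⟩ := ahTexp_iterate_support_aux hτ0 hinc hu n (ahStep w b x) hne
    obtain ⟨h3, h4⟩ := hinc x b hb
    refine ⟨k, ?_, ?_⟩ <;> push_cast <;> linarith

/-- Support propagation under `S_{y',n}` (same statement as for `Tⁿ`; the centre `y'` of the frozen
steps is arbitrary). [cite: AjankiHuveneers2011, Lemma 5.5, proof of (5.19)] -/
theorem ahSy_support_aux (hτ0 : ∀ s ∉ Set.Icc bm bp, τ s = 0) {K₁ K₂ : ℝ}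
    (hinc : ∀ x, ∀ b ∈ Set.Icc bm bp, K₁ * w ≤ ahStep w b x - x ∧ ahStep w b x - x ≤ K₂ * w)
    {u : ℝ → ℝ} {y lo hi : ℝ} (hu : ∀ x, u x ≠ 0 → ∃ k : ℤ, lo < x - y - k ∧ x - y - k < hi)
    (y' : ℝ) :
    ∀ (n : ℕ) (x : ℝ), ahSy τ w h y' n u x ≠ 0 →
      ∃ k : ℤ, lo - K₂ * w * n < x - y - k ∧ x - y - k < hi - K₁ * w * n
  | 0, x, hx => by simpa using hu x hx
  | n + 1, x, hx => by
    rw [ahSy_succ] at hx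
    obtain ⟨b, hb, hne⟩ := exists_ne_zero_of_ahTy_ne_zero hτ0 hx
    obtain ⟨k, h1, h2⟩ := ahSy_support_aux hτ0 hinc hu y' n (ahG w b x _) hne
    obtain ⟨h3, h4⟩ := hinc (y' - (n + 1) * w) b hb
    have h5 := ahG_sub w b x (y' - (n + 1) * w)
    refine ⟨k, ?_, ?_⟩ <;> push_cast <;> linarith

/-- **Cor. 3.4 (i) packaged**: two-sided linear bounds `K₁w ≤ f_b(x) - x ≤ K₂w` on the increments,
`0 < K₁ = (1 + b₋)/2 ≤ K₂ = 2 + b₊`, for `w ≤ w₀(τ)`.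
[cite: AjankiHuveneers2011, Cor. 3.4 (i) and Lemma 5.5 (display after (5.19))] -/
theorem ahStep_increment_linear (hτ : ReducedLawHyp τ bm bp) :
    ∃ w₀ : ℝ, 0 < w₀ ∧ ∃ K₁ K₂ : ℝ, 0 < K₁ ∧ K₁ ≤ K₂ ∧ ∀ w ∈ Set.Ioc 0 w₀,
      ∀ x, ∀ b ∈ Set.Icc bm bp, K₁ * w ≤ ahStep w b x - x ∧ ahStep w b x - x ≤ K₂ * w := by
  obtain ⟨w₁, hw₁, C, hC⟩ :=
    AjankiHuveneers2011_phaseMonotone_holds bm bp hτ.lo hτ.bm_nonpos hτ.bp_nonneg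
  have hbm := hτ.lo
  have hbm0 := hτ.bm_nonpos
  have hbp0 := hτ.bp_nonneg
  have h1bm : 0 < 1 + bm := by linarith
  refine ⟨min w₁ (min ((1 + bm) / (2 * (|C| + 1))) (1 / (|C| + 1))),
    lt_min hw₁ (lt_min (div_pos h1bm (by positivity)) (by positivity)),
    (1 + bm) / 2, 2 + bp, by linarith, by linarith, ?_⟩
  intro w hw x b hb
  obtain ⟨hw0, hwle⟩ := hw
  have hw1 : w ≤ w₁ := hwle.trans (min_le_left _ _)
  have hw2 : w ≤ (1 + bm) / (2 * (|C| + 1)) :=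
    hwle.trans ((min_le_right _ _).trans (min_le_left _ _))
  have hw3 : w ≤ 1 / (|C| + 1) := hwle.trans ((min_le_right _ _).trans (min_le_right _ _))
  obtain ⟨-, hlo, hhi⟩ := hC w ⟨hw0, hw1⟩ x b hb
  have hC0 : 0 < |C| + 1 := by positivity
  have hCw : |C| * w ≤ (|C| + 1) * w := by nlinarith
  have hCw1 : (|C| + 1) * w ≤ 1 := by
    calc (|C| + 1) * w ≤ (|C| + 1) * (1 / (|C| + 1)) := by gcongr
      _ = 1 := by field_simp
  have hCw2 : (|C| + 1) * w ≤ (1 + bm) / 2 := by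
    calc (|C| + 1) * w ≤ (|C| + 1) * ((1 + bm) / (2 * (|C| + 1))) := by gcongr
      _ = (1 + bm) / 2 := by field_simp
  have hCabs : |C * w ^ 2| = |C| * w * w := by
    rw [abs_mul, abs_of_nonneg (sq_nonneg w)]; ring
  have hup : C * w ^ 2 ≤ |C| * w * w := hCabs ▸ le_abs_self _
  have hdn : -(|C| * w * w) ≤ C * w ^ 2 := by
    have := neg_abs_le (C * w ^ 2)
    rwa [hCabs] at this
  constructor
  · nlinarith
  · nlinarith

/-- **Lemma 5.5, eq. (5.19) (localisation of the supports), PROVED** for `Tⁿ`: there are `w₀ > 0`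
and `0 < K₁ ≤ K₂` (depending on `τ` only) such that for `w ∈ (0, w₀]`, every `K`, `n`, `y` and
every `u` vanishing off `B(y, Kw) ⊂ 𝕋`, `Tⁿu` vanishes off `B(y, Kw) + [-K₂wn, -K₁wn]`, i.e.
`Tⁿu(x) ≠ 0` forces `x - y ∈ (-Kw - K₂wn, Kw - K₁wn) + ℤ` ("`supp(Tⁿu) ⊂
[f_{b₊}^{-n}(y - Kw), f_{b₋}^{-n}(y + Kw)]`" and `(1+b₋)w - 𝒪(w²) ≤ x - f_b^{-1}(x) ≤
(1+b₊)w + 𝒪(w²)`). The display (5.19) prints the target set as `[y - K₂wn, y - K₁wn]`, absorbing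
the initial radius `Kw` into the constants; read literally that fails for `n = 0`, and the proof
gives exactly the form stated here. No condition on `h` is needed.
[cite: AjankiHuveneers2011, Lemma 5.5 eq. (5.19)] -/
theorem ahT_iterate_support (hτ : ReducedLawHyp τ bm bp) :
    ∃ w₀ : ℝ, 0 < w₀ ∧ ∃ K₁ K₂ : ℝ, 0 < K₁ ∧ K₁ ≤ K₂ ∧ ∀ w ∈ Set.Ioc 0 w₀,
      ∀ (h : ℝ → ℝ) (K : ℝ) (n : ℕ) (y : ℝ) (u : ℝ → ℝ),
        (∀ x, u x ≠ 0 → ∃ k : ℤ, |x - y - k| < K * w) →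
        ∀ x, (ahT τ w h)^[n] u x ≠ 0 →
          ∃ k : ℤ, -(K * w) - K₂ * w * n < x - y - k ∧ x - y - k < K * w - K₁ * w * n := by
  obtain ⟨w₀, hw₀, K₁, K₂, hK₁, hK₁₂, hinc⟩ := ahStep_increment_linear hτ
  refine ⟨w₀, hw₀, K₁, K₂, hK₁, hK₁₂, fun w hw h K n y u hu x hx => ?_⟩
  exact ahT_iterate_support_aux hτ.eq_zero (hinc w hw)
    (fun z hz => (hu z hz).imp fun k hk => abs_lt.mp hk) n x hx

/-- **Lemma 5.5, eq. (5.19), PROVED** for the exponential-weight iterates `T̃ⁿ` (same statement).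
[cite: AjankiHuveneers2011, Lemma 5.5 eq. (5.19)] -/
theorem ahTexp_iterate_support (hτ : ReducedLawHyp τ bm bp) :
    ∃ w₀ : ℝ, 0 < w₀ ∧ ∃ K₁ K₂ : ℝ, 0 < K₁ ∧ K₁ ≤ K₂ ∧ ∀ w ∈ Set.Ioc 0 w₀,
      ∀ (h : ℝ → ℝ) (K : ℝ) (n : ℕ) (y : ℝ) (u : ℝ → ℝ),
        (∀ x, u x ≠ 0 → ∃ k : ℤ, |x - y - k| < K * w) →
        ∀ x, (ahTexp τ w h)^[n] u x ≠ 0 →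
          ∃ k : ℤ, -(K * w) - K₂ * w * n < x - y - k ∧ x - y - k < K * w - K₁ * w * n := by
  obtain ⟨w₀, hw₀, K₁, K₂, hK₁, hK₁₂, hinc⟩ := ahStep_increment_linear hτ
  refine ⟨w₀, hw₀, K₁, K₂, hK₁, hK₁₂, fun w hw h K n y u hu x hx => ?_⟩
  exact ahTexp_iterate_support_aux hτ.eq_zero (hinc w hw)
    (fun z hz => (hu z hz).imp fun k hk => abs_lt.mp hk) n x hx

/-- **Lemma 5.5, eq. (5.19), PROVED** for `S_{y',n}` (any centre `y'`; the paper takes `y' = y`).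
[cite: AjankiHuveneers2011, Lemma 5.5 eq. (5.19)] -/
theorem ahSy_support (hτ : ReducedLawHyp τ bm bp) :
    ∃ w₀ : ℝ, 0 < w₀ ∧ ∃ K₁ K₂ : ℝ, 0 < K₁ ∧ K₁ ≤ K₂ ∧ ∀ w ∈ Set.Ioc 0 w₀,
      ∀ (h : ℝ → ℝ) (K : ℝ) (y' : ℝ) (n : ℕ) (y : ℝ) (u : ℝ → ℝ),
        (∀ x, u x ≠ 0 → ∃ k : ℤ, |x - y - k| < K * w) →
        ∀ x, ahSy τ w h y' n u x ≠ 0 →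
          ∃ k : ℤ, -(K * w) - K₂ * w * n < x - y - k ∧ x - y - k < K * w - K₁ * w * n := by
  obtain ⟨w₀, hw₀, K₁, K₂, hK₁, hK₁₂, hinc⟩ := ahStep_increment_linear hτ
  refine ⟨w₀, hw₀, K₁, K₂, hK₁, hK₁₂, fun w hw h K y' n y u hu x hx => ?_⟩
  exact ahSy_support_aux hτ.eq_zero (hinc w hw)
    (fun z hz => (hu z hz).imp fun k hk => abs_lt.mp hk) y' n x hx

end Support

/-! ### The expectation of Prop. 5.1 is the `n`-th iterate of `T̃` (proved) -/

section Expectation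

variable {τ : ℝ → ℝ} {w : ℝ} {h : ℝ → ℝ} {bm bp : ℝ}

/-- The random variable `e^{w ∑_{k=1}^n h(X^x_{k-1}) B_k} u(X^x_n)` of Prop. 5.1 as a function of
the disorder `(B_1, …, B_n) ∈ ℝⁿ` (`B k` below is `B_{k+1}`, `X^x = ahPhase w x`).
[cite: AjankiHuveneers2011, Prop. 5.1 eqs. (5.1)-(5.2)] -/
def ahObs (w : ℝ) (h u : ℝ → ℝ) (x : ℝ) (n : ℕ) (B : Fin n → ℝ) : ℝ :=
  Real.exp (w * ∑ k ∈ Finset.range n, h (ahPhase w x (finExt B) k) * finExt B k) *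
    u (ahPhase w x (finExt B) n)

/-- Markov property of the lifted chain: `X^x_{k+1}(B_1, B_2, …) = X^{f_{B_1}(x)}_k(B_2, …)`.
[cite: AjankiHuveneers2011, Def. 3.3 eq. (3.12)] -/
theorem ahPhase_succ_shift (w x : ℝ) (B : ℕ → ℝ) :
    ∀ k, ahPhase w x B (k + 1) = ahPhase w (ahStep w (B 0) x) (fun j => B (j + 1)) k
  | 0 => rfl
  | k + 1 => by rw [ahPhase_succ, ahPhase_succ_shift w x B k, ahPhase_succ]

/-- `finExt (b :: B) 0 = b`. [folklore] -/
theorem finExt_cons_zero {n : ℕ} (b : ℝ) (B : Fin n → ℝ) :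
    finExt (Fin.cons b B : Fin (n + 1) → ℝ) 0 = b := by
  rw [finExt_of_lt _ (Nat.succ_pos n)]
  rfl

/-- `finExt (b :: B) (k + 1) = finExt B k`. [folklore] -/
theorem finExt_cons_succ {n : ℕ} (b : ℝ) (B : Fin n → ℝ) (k : ℕ) :
    finExt (Fin.cons b B : Fin (n + 1) → ℝ) (k + 1) = finExt B k := by
  have h1 : (Fin.cons b B : Fin (n + 1) → ℝ) ∘ Fin.succ = B :=
    funext fun i => Fin.cons_succ (α := fun _ : Fin (n + 1) => ℝ) b B i
  have h2 := finExt_succ (Fin.cons b B : Fin (n + 1) → ℝ)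
  rw [h1] at h2
  exact (congrFun h2 k).symm

/-- The chain driven by `(b :: B)` from `x` is, after one step, the chain driven by `B` from
`f_b(x)`. [cite: AjankiHuveneers2011, Def. 3.3 eq. (3.12)] -/
theorem ahPhase_finExt_cons (w x b : ℝ) {n : ℕ} (B : Fin n → ℝ) (k : ℕ) :
    ahPhase w x (finExt (Fin.cons b B : Fin (n + 1) → ℝ)) (k + 1) =
      ahPhase w (ahStep w b x) (finExt B) k := by
  have h1 : (fun j => finExt (Fin.cons b B : Fin (n + 1) → ℝ) (j + 1)) = finExt B :=
    funext (finExt_cons_succ b B)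
  rw [ahPhase_succ_shift, finExt_cons_zero, h1]

/-- One-step decomposition of the observable:
`e^{w∑_{k=1}^{n+1} h(X_{k-1})B_k} u(X^x_{n+1}) = e^{w h(x) B_1} · [e^{w∑_{k=2}^{n+1} …} u(X^{f_{B_1}(x)}_n)]`.
[cite: AjankiHuveneers2011, §5 eqs. (5.3)-(5.5)] -/
theorem ahObs_cons (w : ℝ) (h u : ℝ → ℝ) (x : ℝ) (n : ℕ) (b : ℝ) (B : Fin n → ℝ) :
    ahObs w h u x (n + 1) (Fin.cons b B) =
      Real.exp (w * h x * b) * ahObs w h u (ahStep w b x) n B := by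
  unfold ahObs
  rw [Finset.sum_range_succ']
  simp only [ahPhase_finExt_cons, finExt_cons_zero, finExt_cons_succ, ahPhase_zero]
  rw [mul_add, Real.exp_add]
  ring

/-- `B ↦ finExt B k` is measurable. [folklore] -/
theorem measurable_finExt {n : ℕ} (k : ℕ) : Measurable fun B : Fin n → ℝ => finExt B k := by
  by_cases hk : k < n
  · simp only [finExt, hk, ↓reduceDIte]
    exact measurable_pi_apply _
  · simp only [finExt, hk, ↓reduceDIte]
    exact measurable_const

/-- `B ↦ X^x_k(B)` is measurable. [folklore] -/
theorem measurable_ahPhase_pi (w x : ℝ) {n : ℕ} :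
    ∀ k, Measurable fun B : Fin n → ℝ => ahPhase w x (finExt B) k
  | 0 => measurable_const
  | k + 1 => by
    have : (fun B : Fin n → ℝ => ahPhase w x (finExt B) (k + 1)) =
        (fun p : ℝ × ℝ => ahStep w p.2 p.1) ∘
          fun B => (ahPhase w x (finExt B) k, finExt B k) := rfl
    rw [this]
    exact (measurable_ahStep₂ w).comp ((measurable_ahPhase_pi w x k).prodMk (measurable_finExt k))

/-- The observable is measurable in the disorder. [folklore] -/
theorem measurable_ahObs (hh : Measurable h) {u : ℝ → ℝ} (hu : Measurable u) (w x : ℝ) (n : ℕ) :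
    Measurable (ahObs w h u x n) := by
  unfold ahObs
  have hs : Measurable fun B : Fin n → ℝ =>
      ∑ k ∈ Finset.range n, h (ahPhase w x (finExt B) k) * finExt B k :=
    Finset.measurable_sum _ fun k _ =>
      (hh.comp (measurable_ahPhase_pi w x k)).mul (measurable_finExt k)
  exact (Real.measurable_exp.comp (measurable_const.mul hs)).mul
    (hu.comp (measurable_ahPhase_pi w x n))

/-- `|finExt B k| ≤ b_*` when all `B i ∈ [b₋, b₊]`. [folklore] -/
theorem abs_finExt_le {n : ℕ} {B : Fin n → ℝ} (hB : ∀ i, bm ≤ B i ∧ B i ≤ bp) (k : ℕ) :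
    |finExt B k| ≤ max |bm| |bp| := by
  by_cases hk : k < n
  · rw [finExt_of_lt _ hk]
    exact ReducedLawHyp.abs_le_of_mem ⟨(hB _).1, (hB _).2⟩
  · simp only [finExt, hk, ↓reduceDIte, abs_zero]
    positivity

/-- A.s. bound on the observable: `|e^{w∑…} u(X_n)| ≤ e^{|w| n H b_*} M`. [folklore] -/
theorem abs_ahObs_le {H M : ℝ} (hH : ∀ z, |h z| ≤ H) {u : ℝ → ℝ} (hM : ∀ z, |u z| ≤ M)
    (w x : ℝ) {n : ℕ} {B : Fin n → ℝ} (hB : ∀ i, bm ≤ B i ∧ B i ≤ bp) :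
    |ahObs w h u x n B| ≤ Real.exp (|w| * (n * (H * max |bm| |bp|))) * M := by
  unfold ahObs
  rw [abs_mul, Real.abs_exp]
  have hH0 : 0 ≤ H := (abs_nonneg _).trans (hH 0)
  have hsum : |∑ k ∈ Finset.range n, h (ahPhase w x (finExt B) k) * finExt B k| ≤
      n * (H * max |bm| |bp|) := by
    calc |∑ k ∈ Finset.range n, h (ahPhase w x (finExt B) k) * finExt B k|
        ≤ ∑ k ∈ Finset.range n, |h (ahPhase w x (finExt B) k) * finExt B k| :=
          Finset.abs_sum_le_sum_abs _ _
      _ ≤ ∑ _k ∈ Finset.range n, H * max |bm| |bp| := by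
          refine Finset.sum_le_sum fun k _ => ?_
          rw [abs_mul]
          exact mul_le_mul (hH _) (abs_finExt_le hB k) (abs_nonneg _) hH0
      _ = n * (H * max |bm| |bp|) := by simp
  have hexp : w * ∑ k ∈ Finset.range n, h (ahPhase w x (finExt B) k) * finExt B k ≤
      |w| * (n * (H * max |bm| |bp|)) := by
    calc w * ∑ k ∈ Finset.range n, h (ahPhase w x (finExt B) k) * finExt B k
        ≤ |w * ∑ k ∈ Finset.range n, h (ahPhase w x (finExt B) k) * finExt B k| := le_abs_self _
      _ = |w| * |∑ k ∈ Finset.range n, h (ahPhase w x (finExt B) k) * finExt B k| := abs_mul _ _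
      _ ≤ |w| * (n * (H * max |bm| |bp|)) := mul_le_mul_of_nonneg_left hsum (abs_nonneg w)
  exact mul_le_mul (Real.exp_le_exp.mpr hexp) (hM _) (abs_nonneg _) (Real.exp_pos _).le

/-- **Finiteness of the expectation**: the observable of Prop. 5.1 is integrable against
`τ^{⊗n}` for bounded Borel `u` and bounded Borel `h` (the masses are a.s. in `[b₋, b₊]`).
[cite: AjankiHuveneers2011, Prop. 5.1] -/
theorem integrable_ahObs (hτ : ReducedLawHyp τ bm bp) {ρB : Measure ℝ} [IsProbabilityMeasure ρB]
    (hρ : ρB = volume.withDensity fun s => ENNReal.ofReal (τ s)) (hh : Measurable h) {H : ℝ}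
    (hH : ∀ z, |h z| ≤ H) {u : ℝ → ℝ} (hu : Measurable u) {M : ℝ} (hM : ∀ z, |u z| ≤ M)
    (w x : ℝ) (n : ℕ) : Integrable (ahObs w h u x n) (Measure.pi fun _ : Fin n => ρB) := by
  refine Integrable.mono' (integrable_const (Real.exp (|w| * (n * (H * max |bm| |bp|))) * M))
    (measurable_ahObs hh hu w x n).aestronglyMeasurable ?_
  filter_upwards [ae_pi_mem_Icc hτ.eq_zero hρ n] with B hB
  rw [Real.norm_eq_abs]
  exact abs_ahObs_le hH hM w x hB

/-- `∫ g dρ_B = ∫ g(b) τ(b) db` for the law `ρ_B = τ(b) db`. [folklore] -/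
theorem integral_rhoB (hτ : ReducedLawHyp τ bm bp) {ρB : Measure ℝ}
    (hρ : ρB = volume.withDensity fun s => ENNReal.ofReal (τ s)) (g : ℝ → ℝ) :
    ∫ b, g b ∂ρB = ∫ b, g b * τ b := by
  rw [hρ, integral_withDensity_eq_integral_toReal_smul hτ.measurable.ennreal_ofReal
    (ae_of_all _ fun _ => ENNReal.ofReal_lt_top)]
  refine integral_congr_ae (ae_of_all _ fun b => ?_)
  show (ENNReal.ofReal (τ b)).toReal • g b = g b * τ b
  rw [ENNReal.toReal_ofReal (hτ.nonneg b), smul_eq_mul, mul_comm]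

/-- **`T̃ⁿu(x) = 𝔼(e^{w ∑_{k=1}^n h(X^x_{k-1}) B_k} u(X^x_n))`** — the iterates of the
exponential-weight transition operator are exactly the expectations of Prop. 5.1 (Markov property
and Fubini over `τ^{⊗(n+1)} = τ ⊗ τ^{⊗n}`), for bounded Borel `u` and `h`.
[cite: AjankiHuveneers2011, §5 eqs. (5.3)-(5.5)] -/
theorem ahTexp_iterate_eq_integral (hτ : ReducedLawHyp τ bm bp) {ρB : Measure ℝ}
    [IsProbabilityMeasure ρB] (hρ : ρB = volume.withDensity fun s => ENNReal.ofReal (τ s))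
    (hh : Measurable h) {H : ℝ} (hH : ∀ z, |h z| ≤ H) {u : ℝ → ℝ} (hu : Measurable u) {M : ℝ}
    (hM : ∀ z, |u z| ≤ M) (w : ℝ) :
    ∀ (n : ℕ) (x : ℝ), (ahTexp τ w h)^[n] u x =
      ∫ B, ahObs w h u x n B ∂(Measure.pi fun _ : Fin n => ρB)
  | 0, x => by simp [ahObs]
  | n + 1, x => by
    rw [Function.iterate_succ_apply']
    have e := measurePreserving_piFinSuccAbove (fun _ : Fin (n + 1) => ρB) 0
    have e' := e.symm _
    have hI := integrable_ahObs hτ hρ hh hH hu hM w x (n + 1)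
    have hsymm : ∀ p : ℝ × (Fin n → ℝ),
        (MeasurableEquiv.piFinSuccAbove (fun _ : Fin (n + 1) => ℝ) 0).symm p = Fin.cons p.1 p.2 :=
      fun p => by rw [← Fin.insertNth_zero']; rfl
    rw [← e'.integral_comp']
    rw [integral_prod (fun p : ℝ × (Fin n → ℝ) =>
        ahObs w h u x (n + 1) ((MeasurableEquiv.piFinSuccAbove (fun _ : Fin (n + 1) => ℝ) 0).symm p))
      ((e'.integrable_comp_emb (MeasurableEquiv.measurableEmbedding _)).mpr hI)]
    simp only [hsymm, ahObs_cons]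
    have hin : ∀ b : ℝ, ∫ B : Fin n → ℝ, Real.exp (w * h x * b) * ahObs w h u (ahStep w b x) n B
        ∂(Measure.pi fun _ : Fin n => ρB) =
        (ahTexp τ w h)^[n] u (ahStep w b x) * Real.exp (w * h x * b) := fun b => by
      rw [integral_const_mul, ahTexp_iterate_eq_integral hτ hρ hh hH hu hM w n (ahStep w b x),
        mul_comm]
    simp only [hin]
    rw [integral_rhoB hτ hρ]
    unfold ahTexp
    simp only [mul_assoc]

end Expectation

/-! ### (5.5): `Tⁿ ≤ T̃ⁿ ≤ e^{Cw²n} Tⁿ` on non-negative bounded Borel functions (proved) -/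

section Comparison

variable {τ : ℝ → ℝ} {w : ℝ} {h : ℝ → ℝ} {bm bp : ℝ}

/-- `e^t ≤ (1 + t) e^{2t²}` for `|t| ≤ 1/2` (from `1 - t ≤ e^{-t}` and `1 + 2t² ≤ e^{2t²}`): the
scalar inequality behind "`e^{w h(x) b} = (1 + w h(x) b) · e^{𝒪(w²)}`" (5.4). [folklore] -/
theorem exp_le_one_add_mul_exp {t : ℝ} (ht : |t| ≤ 1 / 2) :
    Real.exp t ≤ (1 + t) * Real.exp (2 * t ^ 2) := by
  obtain ⟨ht1, ht2⟩ := abs_le.mp ht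
  have hsq : t ^ 2 ≤ 1 / 4 := by nlinarith
  have h1 : (1 - t) * Real.exp t ≤ 1 := by
    have := Real.add_one_le_exp (-t)
    calc (1 - t) * Real.exp t ≤ Real.exp (-t) * Real.exp t := by
          refine mul_le_mul_of_nonneg_right (by linarith) (Real.exp_pos _).le
      _ = 1 := by rw [← Real.exp_add]; simp
  have h2 : 1 ≤ (1 - t ^ 2) * Real.exp (2 * t ^ 2) := by
    have he := Real.add_one_le_exp (2 * t ^ 2)
    have h0 : 0 ≤ 1 - t ^ 2 := by linarith
    calc (1 : ℝ) ≤ (1 - t ^ 2) * (2 * t ^ 2 + 1) := by nlinarith [sq_nonneg t]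
      _ ≤ (1 - t ^ 2) * Real.exp (2 * t ^ 2) := mul_le_mul_of_nonneg_left he h0
  calc Real.exp t = Real.exp t * 1 := (mul_one _).symm
    _ ≤ Real.exp t * ((1 - t ^ 2) * Real.exp (2 * t ^ 2)) :=
        mul_le_mul_of_nonneg_left h2 (Real.exp_pos _).le
    _ = (1 - t) * Real.exp t * ((1 + t) * Real.exp (2 * t ^ 2)) := by ring
    _ ≤ 1 * ((1 + t) * Real.exp (2 * t ^ 2)) :=
        mul_le_mul_of_nonneg_right h1 (mul_nonneg (by linarith) (Real.exp_pos _).le)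
    _ = (1 + t) * Real.exp (2 * t ^ 2) := one_mul _

/-- On the support of `τ`, `|w h(x) b| ≤ w H b_*` when `|h| ≤ H`, `w ≥ 0`. [folklore] -/
theorem abs_weightArg_le {H x b : ℝ} (hw : 0 ≤ w) (hH : ∀ z, |h z| ≤ H)
    (hb : b ∈ Set.Icc bm bp) : |w * h x * b| ≤ w * H * max |bm| |bp| := by
  rw [abs_mul, abs_mul, abs_of_nonneg hw]
  have hH0 : 0 ≤ H := (abs_nonneg _).trans (hH 0)
  exact mul_le_mul (mul_le_mul_of_nonneg_left (hH x) hw) (ReducedLawHyp.abs_le_of_mem hb)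
    (abs_nonneg _) (mul_nonneg hw hH0)

/-- The integrand of `T v(x)` is integrable for bounded Borel `v`. [folklore] -/
theorem integrable_ahT_integrand (hτ : ReducedLawHyp τ bm bp) {v : ℝ → ℝ} (hv : Measurable v)
    {M : ℝ} (hM : ∀ z, |v z| ≤ M) (w : ℝ) (h : ℝ → ℝ) (x : ℝ) :
    Integrable fun b => v (ahStep w b x) * ((1 + w * h x * b) * τ b) := by
  have h1 : Integrable fun b => (v (ahStep w b x) * (1 + w * h x * b)) * τ b := by
    refine hτ.integrable_mul ?_ (C := M * (1 + |w| * |h x| * max |bm| |bp|)) fun b hb => ?_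
    · exact ((hv.comp (measurable_ahStep_right w x)).mul
        (measurable_const.add (measurable_const.mul measurable_id))).aestronglyMeasurable
    · rw [abs_mul]
      refine mul_le_mul (hM _) ?_ (abs_nonneg _) ((abs_nonneg _).trans (hM 0))
      calc |1 + w * h x * b| ≤ |(1 : ℝ)| + |w * h x * b| := abs_add_le _ _
        _ = 1 + |w| * |h x| * |b| := by rw [abs_one, abs_mul, abs_mul]
        _ ≤ 1 + |w| * |h x| * max |bm| |bp| := by
            gcongr
            exact ReducedLawHyp.abs_le_of_mem hb
  simpa only [mul_assoc] using h1

/-- The integrand of `T̃ v(x)` is integrable for bounded Borel `v`. [folklore] -/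
theorem integrable_ahTexp_integrand (hτ : ReducedLawHyp τ bm bp) {v : ℝ → ℝ} (hv : Measurable v)
    {M : ℝ} (hM : ∀ z, |v z| ≤ M) (w : ℝ) (h : ℝ → ℝ) (x : ℝ) :
    Integrable fun b => v (ahStep w b x) * (Real.exp (w * h x * b) * τ b) := by
  have h1 : Integrable fun b => (v (ahStep w b x) * Real.exp (w * h x * b)) * τ b := by
    refine hτ.integrable_mul ?_ (C := M * Real.exp (|w| * |h x| * max |bm| |bp|)) fun b hb => ?_
    · exact ((hv.comp (measurable_ahStep_right w x)).mul
        (Real.measurable_exp.comp (measurable_const.mul measurable_id))).aestronglyMeasurable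
    · rw [abs_mul, Real.abs_exp]
      refine mul_le_mul (hM _) (Real.exp_le_exp.mpr ?_) (Real.exp_pos _).le
        ((abs_nonneg _).trans (hM 0))
      calc w * h x * b ≤ |w * h x * b| := le_abs_self _
        _ = |w| * |h x| * |b| := by rw [abs_mul, abs_mul]
        _ ≤ |w| * |h x| * max |bm| |bp| := by
            gcongr
            exact ReducedLawHyp.abs_le_of_mem hb
  simpa only [mul_assoc] using h1

/-- The integrand of `T_y v(x)` is integrable for bounded Borel `v`. [folklore] -/
theorem integrable_ahTy_integrand (hτ : ReducedLawHyp τ bm bp) {v : ℝ → ℝ} (hv : Measurable v)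
    {M : ℝ} (hM : ∀ z, |v z| ≤ M) (w : ℝ) (h : ℝ → ℝ) (y x : ℝ) :
    Integrable fun b => v (ahG w b x y) * ((1 + w * h y * b) * τ b) := by
  have hG : Measurable fun b => ahG w b x y := by
    unfold ahG
    exact measurable_const.add (measurable_ahPhi_right w y)
  have h1 : Integrable fun b => (v (ahG w b x y) * (1 + w * h y * b)) * τ b := by
    refine hτ.integrable_mul ?_ (C := M * (1 + |w| * |h y| * max |bm| |bp|)) fun b hb => ?_
    · exact ((hv.comp hG).mul
        (measurable_const.add (measurable_const.mul measurable_id))).aestronglyMeasurable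
    · rw [abs_mul]
      refine mul_le_mul (hM _) ?_ (abs_nonneg _) ((abs_nonneg _).trans (hM 0))
      calc |1 + w * h y * b| ≤ |(1 : ℝ)| + |w * h y * b| := abs_add_le _ _
        _ = 1 + |w| * |h y| * |b| := by rw [abs_one, abs_mul, abs_mul]
        _ ≤ 1 + |w| * |h y| * max |bm| |bp| := by
            gcongr
            exact ReducedLawHyp.abs_le_of_mem hb
  simpa only [mul_assoc] using h1

/-- **`‖T‖_{∞→∞} ≤ 1 + |w| ‖h‖_∞ b_*`** (and `= 1` once the weight is non-negative, cf. `ahT_one`):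
`|T v(x)| ≤ M (1 + |w| |h(x)| b_*)` for `|v| ≤ M`. [cite: AjankiHuveneers2011, §5 after eq. (5.3)] -/
theorem abs_ahT_le (hτ : ReducedLawHyp τ bm bp) {v : ℝ → ℝ} {M : ℝ} (hM : ∀ z, |v z| ≤ M)
    (w : ℝ) (h : ℝ → ℝ) (x : ℝ) : |ahT τ w h v x| ≤ M * (1 + |w| * |h x| * max |bm| |bp|) := by
  have hM0 : 0 ≤ M := (abs_nonneg _).trans (hM 0)
  have hg : Integrable fun b => M * (1 + |w| * |h x| * max |bm| |bp|) * τ b :=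
    hτ.integrable.const_mul _
  unfold ahT
  calc |∫ b, v (ahStep w b x) * ((1 + w * h x * b) * τ b)|
      ≤ ∫ b, M * (1 + |w| * |h x| * max |bm| |bp|) * τ b := by
        rw [← Real.norm_eq_abs]
        refine norm_integral_le_of_norm_le hg (ae_of_all _ fun b => ?_)
        rw [Real.norm_eq_abs]
        by_cases hb : b ∈ Set.Icc bm bp
        · rw [abs_mul, abs_mul, abs_of_nonneg (hτ.nonneg b)]
          have h1 : |1 + w * h x * b| ≤ 1 + |w| * |h x| * max |bm| |bp| := by
            calc |1 + w * h x * b| ≤ |(1 : ℝ)| + |w * h x * b| := abs_add_le _ _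
              _ = 1 + |w| * |h x| * |b| := by rw [abs_one, abs_mul, abs_mul]
              _ ≤ 1 + |w| * |h x| * max |bm| |bp| := by
                  gcongr
                  exact ReducedLawHyp.abs_le_of_mem hb
          calc |v (ahStep w b x)| * (|1 + w * h x * b| * τ b)
              ≤ M * ((1 + |w| * |h x| * max |bm| |bp|) * τ b) :=
                mul_le_mul (hM _) (mul_le_mul_of_nonneg_right h1 (hτ.nonneg b))
                  (mul_nonneg (abs_nonneg _) (hτ.nonneg b)) hM0
            _ = M * (1 + |w| * |h x| * max |bm| |bp|) * τ b := by ring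
        · rw [hτ.eq_zero b hb]
          simp
    _ = M * (1 + |w| * |h x| * max |bm| |bp|) := by
        rw [integral_const_mul, hτ.integral_eq_one, mul_one]

/-- `|T̃ v(x)| ≤ M e^{|w| |h(x)| b_*}` for `|v| ≤ M`. [cite: AjankiHuveneers2011, §5 eqs. (5.4)-(5.5)] -/
theorem abs_ahTexp_le (hτ : ReducedLawHyp τ bm bp) {v : ℝ → ℝ} {M : ℝ} (hM : ∀ z, |v z| ≤ M)
    (w : ℝ) (h : ℝ → ℝ) (x : ℝ) :
    |ahTexp τ w h v x| ≤ M * Real.exp (|w| * |h x| * max |bm| |bp|) := by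
  have hM0 : 0 ≤ M := (abs_nonneg _).trans (hM 0)
  have hg : Integrable fun b => M * Real.exp (|w| * |h x| * max |bm| |bp|) * τ b :=
    hτ.integrable.const_mul _
  unfold ahTexp
  calc |∫ b, v (ahStep w b x) * (Real.exp (w * h x * b) * τ b)|
      ≤ ∫ b, M * Real.exp (|w| * |h x| * max |bm| |bp|) * τ b := by
        rw [← Real.norm_eq_abs]
        refine norm_integral_le_of_norm_le hg (ae_of_all _ fun b => ?_)
        rw [Real.norm_eq_abs]
        by_cases hb : b ∈ Set.Icc bm bp
        · rw [abs_mul, abs_mul, abs_of_nonneg (hτ.nonneg b), Real.abs_exp]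
          have h1 : Real.exp (w * h x * b) ≤ Real.exp (|w| * |h x| * max |bm| |bp|) := by
            refine Real.exp_le_exp.mpr ?_
            calc w * h x * b ≤ |w * h x * b| := le_abs_self _
              _ = |w| * |h x| * |b| := by rw [abs_mul, abs_mul]
              _ ≤ |w| * |h x| * max |bm| |bp| := by
                  gcongr
                  exact ReducedLawHyp.abs_le_of_mem hb
          calc |v (ahStep w b x)| * (Real.exp (w * h x * b) * τ b)
              ≤ M * (Real.exp (|w| * |h x| * max |bm| |bp|) * τ b) :=
                mul_le_mul (hM _) (mul_le_mul_of_nonneg_right h1 (hτ.nonneg b))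
                  (mul_nonneg (Real.exp_pos _).le (hτ.nonneg b)) hM0
            _ = M * Real.exp (|w| * |h x| * max |bm| |bp|) * τ b := by ring
        · rw [hτ.eq_zero b hb]
          simp
    _ = M * Real.exp (|w| * |h x| * max |bm| |bp|) := by
        rw [integral_const_mul, hτ.integral_eq_one, mul_one]

/-- `x ↦ T v(x)` is Borel measurable for Borel `v`, `h`. [folklore] -/
theorem measurable_ahT (hτ : ReducedLawHyp τ bm bp) (hh : Measurable h) {v : ℝ → ℝ}
    (hv : Measurable v) (w : ℝ) : Measurable (ahT τ w h v) := by
  have hF : StronglyMeasurable fun p : ℝ × ℝ =>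
      v (ahStep w p.2 p.1) * ((1 + w * h p.1 * p.2) * τ p.2) :=
    Measurable.stronglyMeasurable <|
      (hv.comp (measurable_ahStep₂ w)).mul
        ((measurable_const.add ((measurable_const.mul (hh.comp measurable_fst)).mul
          measurable_snd)).mul (hτ.measurable.comp measurable_snd))
  exact (hF.integral_prod_right' (ν := volume)).measurable

/-- `x ↦ T̃ v(x)` is Borel measurable for Borel `v`, `h`. [folklore] -/
theorem measurable_ahTexp (hτ : ReducedLawHyp τ bm bp) (hh : Measurable h) {v : ℝ → ℝ}
    (hv : Measurable v) (w : ℝ) : Measurable (ahTexp τ w h v) := by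
  have hF : StronglyMeasurable fun p : ℝ × ℝ =>
      v (ahStep w p.2 p.1) * (Real.exp (w * h p.1 * p.2) * τ p.2) :=
    Measurable.stronglyMeasurable <|
      (hv.comp (measurable_ahStep₂ w)).mul
        ((Real.measurable_exp.comp ((measurable_const.mul (hh.comp measurable_fst)).mul
          measurable_snd)).mul (hτ.measurable.comp measurable_snd))
  exact (hF.integral_prod_right' (ν := volume)).measurable

/-- `x ↦ T_y v(x)` is Borel measurable for Borel `v`. [folklore] -/
theorem measurable_ahTy (hτ : ReducedLawHyp τ bm bp) {v : ℝ → ℝ} (hv : Measurable v) (w : ℝ)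
    (h : ℝ → ℝ) (y : ℝ) : Measurable (ahTy τ w h y v) := by
  have hG : Measurable fun p : ℝ × ℝ => ahG w p.2 p.1 y := by
    unfold ahG
    exact (measurable_fst.add_const _).add ((measurable_ahPhi_right w y).comp measurable_snd)
  have hF : StronglyMeasurable fun p : ℝ × ℝ =>
      v (ahG w p.2 p.1 y) * ((1 + w * h y * p.2) * τ p.2) :=
    Measurable.stronglyMeasurable <|
      (hv.comp hG).mul ((measurable_const.add (measurable_const.mul measurable_snd)).mul
        (hτ.measurable.comp measurable_snd))
  exact (hF.integral_prod_right' (ν := volume)).measurable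

/-- **Monotonicity of `T`** ("if `u₁ ≥ u₂`, one has `Tu₁ ≥ Tu₂`") on bounded Borel functions,
for non-negative weights (`w |h(x)| b_* ≤ 1`). [cite: AjankiHuveneers2011, §5, proof of Prop. 5.1 ("Third")] -/
theorem ahT_mono (hτ : ReducedLawHyp τ bm bp) {v₁ v₂ : ℝ → ℝ} (hv₁ : Measurable v₁)
    (hv₂ : Measurable v₂) {M₁ M₂ : ℝ} (hM₁ : ∀ z, |v₁ z| ≤ M₁) (hM₂ : ∀ z, |v₂ z| ≤ M₂)
    (hle : ∀ z, v₁ z ≤ v₂ z) (hw : 0 ≤ w) {x : ℝ} (hwh : w * |h x| * max |bm| |bp| ≤ 1) :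
    ahT τ w h v₁ x ≤ ahT τ w h v₂ x := by
  refine integral_mono (integrable_ahT_integrand hτ hv₁ hM₁ w h x)
    (integrable_ahT_integrand hτ hv₂ hM₂ w h x) fun b => ?_
  by_cases hb : b ∈ Set.Icc bm bp
  · exact mul_le_mul_of_nonneg_right (hle _) (mul_nonneg (ahWeight_nonneg hw hwh hb) (hτ.nonneg b))
  · simp [hτ.eq_zero b hb]

/-- Monotonicity of `T̃` on bounded Borel functions. [cite: AjankiHuveneers2011, §5 eqs. (5.4)-(5.5)] -/
theorem ahTexp_mono (hτ : ReducedLawHyp τ bm bp) {v₁ v₂ : ℝ → ℝ} (hv₁ : Measurable v₁)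
    (hv₂ : Measurable v₂) {M₁ M₂ : ℝ} (hM₁ : ∀ z, |v₁ z| ≤ M₁) (hM₂ : ∀ z, |v₂ z| ≤ M₂)
    (hle : ∀ z, v₁ z ≤ v₂ z) (x : ℝ) : ahTexp τ w h v₁ x ≤ ahTexp τ w h v₂ x := by
  refine integral_mono (integrable_ahTexp_integrand hτ hv₁ hM₁ w h x)
    (integrable_ahTexp_integrand hτ hv₂ hM₂ w h x) fun b => ?_
  exact mul_le_mul_of_nonneg_right (hle _) (mul_nonneg (Real.exp_pos _).le (hτ.nonneg b))

/-- Monotonicity of `T_y` on bounded Borel functions (non-negative weight, `w |h(y)| b_* ≤ 1`).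
[cite: AjankiHuveneers2011, §5 eq. (5.6)] -/
theorem ahTy_mono (hτ : ReducedLawHyp τ bm bp) {v₁ v₂ : ℝ → ℝ} (hv₁ : Measurable v₁)
    (hv₂ : Measurable v₂) {M₁ M₂ : ℝ} (hM₁ : ∀ z, |v₁ z| ≤ M₁) (hM₂ : ∀ z, |v₂ z| ≤ M₂)
    (hle : ∀ z, v₁ z ≤ v₂ z) (hw : 0 ≤ w) {y : ℝ} (hwh : w * |h y| * max |bm| |bp| ≤ 1) (x : ℝ) :
    ahTy τ w h y v₁ x ≤ ahTy τ w h y v₂ x := by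
  refine integral_mono (integrable_ahTy_integrand hτ hv₁ hM₁ w h y x)
    (integrable_ahTy_integrand hτ hv₂ hM₂ w h y x) fun b => ?_
  by_cases hb : b ∈ Set.Icc bm bp
  · exact mul_le_mul_of_nonneg_right (hle _) (mul_nonneg (ahWeight_nonneg hw hwh hb) (hτ.nonneg b))
  · simp [hτ.eq_zero b hb]

/-- `T̃` commutes with scalars. [folklore] -/
theorem ahTexp_const_mul (τ : ℝ → ℝ) (w : ℝ) (h : ℝ → ℝ) (c : ℝ) (v : ℝ → ℝ) (x : ℝ) :
    ahTexp τ w h (fun z => c * v z) x = c * ahTexp τ w h v x := by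
  unfold ahTexp
  rw [← integral_const_mul]
  congr 1
  funext b
  ring

/-- `T` commutes with scalars. [folklore] -/
theorem ahT_const_mul (τ : ℝ → ℝ) (w : ℝ) (h : ℝ → ℝ) (c : ℝ) (v : ℝ → ℝ) (x : ℝ) :
    ahT τ w h (fun z => c * v z) x = c * ahT τ w h v x := by
  unfold ahT
  rw [← integral_const_mul]
  congr 1
  funext b
  ring

/-- **`T v ≤ T̃ v` for `v ≥ 0`** (`1 + t ≤ e^t`). [cite: AjankiHuveneers2011, §5 eqs. (5.4)-(5.5)] -/
theorem ahT_le_ahTexp (hτ : ReducedLawHyp τ bm bp) {v : ℝ → ℝ} (hv : Measurable v) {M : ℝ}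
    (hM : ∀ z, |v z| ≤ M) (hv0 : ∀ z, 0 ≤ v z) (x : ℝ) : ahT τ w h v x ≤ ahTexp τ w h v x := by
  refine integral_mono (integrable_ahT_integrand hτ hv hM w h x)
    (integrable_ahTexp_integrand hτ hv hM w h x) fun b => ?_
  refine mul_le_mul_of_nonneg_left (mul_le_mul_of_nonneg_right ?_ (hτ.nonneg b)) (hv0 _)
  have := Real.add_one_le_exp (w * h x * b)
  linarith

/-- **`T̃ v ≤ e^{2(wHb_*)²} T v` for `v ≥ 0`**, `|h| ≤ H`, `w H b_* ≤ 1/2` (`e^t ≤ (1+t)e^{2t²}`):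
the quantitative form of "`e^{wh(x)b} = (1 + wh(x)b) · e^{𝒪(w²)}`" (5.4).
[cite: AjankiHuveneers2011, §5 eqs. (5.4)-(5.5)] -/
theorem ahTexp_le_ahT (hτ : ReducedLawHyp τ bm bp) {v : ℝ → ℝ} (hv : Measurable v) {M : ℝ}
    (hM : ∀ z, |v z| ≤ M) (hv0 : ∀ z, 0 ≤ v z) (hw : 0 ≤ w) {H : ℝ} (hH : ∀ z, |h z| ≤ H)
    (hwH : w * H * max |bm| |bp| ≤ 1 / 2) (x : ℝ) :
    ahTexp τ w h v x ≤ Real.exp (2 * (w * H * max |bm| |bp|) ^ 2) * ahT τ w h v x := by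
  rw [← ahT_const_mul]
  have hM0 : 0 ≤ M := (abs_nonneg _).trans (hM 0)
  have hcM : ∀ z, |Real.exp (2 * (w * H * max |bm| |bp|) ^ 2) * v z| ≤
      Real.exp (2 * (w * H * max |bm| |bp|) ^ 2) * M := fun z => by
    rw [abs_mul, Real.abs_exp]
    exact mul_le_mul_of_nonneg_left (hM z) (Real.exp_pos _).le
  refine integral_mono (integrable_ahTexp_integrand hτ hv hM w h x)
    (integrable_ahT_integrand hτ (measurable_const.mul hv) hcM w h x) fun b => ?_
  by_cases hb : b ∈ Set.Icc bm bp
  · have ht : |w * h x * b| ≤ w * H * max |bm| |bp| := abs_weightArg_le hw hH hb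
    have ht' : |w * h x * b| ≤ 1 / 2 := ht.trans hwH
    have h1 := exp_le_one_add_mul_exp ht'
    have h2 : Real.exp (2 * (w * h x * b) ^ 2) ≤ Real.exp (2 * (w * H * max |bm| |bp|) ^ 2) := by
      refine Real.exp_le_exp.mpr (mul_le_mul_of_nonneg_left ?_ (by norm_num))
      obtain ⟨h3, h4⟩ := abs_le.mp ht
      exact sq_le_sq' h3 h4
    have h1t : 0 ≤ 1 + w * h x * b := by linarith [(abs_le.mp ht').1]
    show v (ahStep w b x) * (Real.exp (w * h x * b) * τ b) ≤
      Real.exp (2 * (w * H * max |bm| |bp|) ^ 2) * v (ahStep w b x) * ((1 + w * h x * b) * τ b)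
    calc v (ahStep w b x) * (Real.exp (w * h x * b) * τ b)
        ≤ v (ahStep w b x) * ((1 + w * h x * b) * Real.exp (2 * (w * h x * b) ^ 2) * τ b) :=
          mul_le_mul_of_nonneg_left (mul_le_mul_of_nonneg_right h1 (hτ.nonneg b)) (hv0 _)
      _ ≤ v (ahStep w b x) *
            ((1 + w * h x * b) * Real.exp (2 * (w * H * max |bm| |bp|) ^ 2) * τ b) :=
          mul_le_mul_of_nonneg_left (mul_le_mul_of_nonneg_right
            (mul_le_mul_of_nonneg_left h2 h1t) (hτ.nonneg b)) (hv0 _)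
      _ = Real.exp (2 * (w * H * max |bm| |bp|) ^ 2) * v (ahStep w b x) *
            ((1 + w * h x * b) * τ b) := by ring
  · simp [hτ.eq_zero b hb]

/-- Closure of "non-negative bounded Borel" under `T` (for `w H b_* ≤ 1`). [folklore] -/
theorem ahT_closure (hτ : ReducedLawHyp τ bm bp) (hh : Measurable h) {H : ℝ} (hH : ∀ z, |h z| ≤ H)
    (hw : 0 ≤ w) (hwH : w * H * max |bm| |bp| ≤ 1) {v : ℝ → ℝ} (hv : Measurable v)
    (hvb : ∃ M, ∀ z, |v z| ≤ M) (hv0 : ∀ z, 0 ≤ v z) :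
    Measurable (ahT τ w h v) ∧ (∃ M, ∀ z, |ahT τ w h v z| ≤ M) ∧ ∀ z, 0 ≤ ahT τ w h v z := by
  obtain ⟨M, hM⟩ := hvb
  have hH0 : 0 ≤ H := (abs_nonneg _).trans (hH 0)
  have hwh : ∀ x, w * |h x| * max |bm| |bp| ≤ 1 := fun x =>
    (mul_le_mul_of_nonneg_right (mul_le_mul_of_nonneg_left (hH x) hw) (by positivity)).trans hwH
  refine ⟨measurable_ahT hτ hh hv w, ⟨M * (1 + |w| * H * max |bm| |bp|), fun z => ?_⟩,
    fun z => ahT_nonneg hτ hv0 hw (hwh z)⟩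
  refine (abs_ahT_le hτ hM w h z).trans ?_
  have hM0 : 0 ≤ M := (abs_nonneg _).trans (hM 0)
  gcongr
  exact hH z

/-- Closure of "non-negative bounded Borel" under `T̃`. [folklore] -/
theorem ahTexp_closure (hτ : ReducedLawHyp τ bm bp) (hh : Measurable h) {H : ℝ}
    (hH : ∀ z, |h z| ≤ H) (w : ℝ) {v : ℝ → ℝ} (hv : Measurable v) (hvb : ∃ M, ∀ z, |v z| ≤ M)
    (hv0 : ∀ z, 0 ≤ v z) :
    Measurable (ahTexp τ w h v) ∧ (∃ M, ∀ z, |ahTexp τ w h v z| ≤ M) ∧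
      ∀ z, 0 ≤ ahTexp τ w h v z := by
  obtain ⟨M, hM⟩ := hvb
  have hH0 : 0 ≤ H := (abs_nonneg _).trans (hH 0)
  refine ⟨measurable_ahTexp hτ hh hv w, ⟨M * Real.exp (|w| * H * max |bm| |bp|), fun z => ?_⟩,
    fun z => ahTexp_nonneg hτ hv0 z⟩
  refine (abs_ahTexp_le hτ hM w h z).trans ?_
  have hM0 : 0 ≤ M := (abs_nonneg _).trans (hM 0)
  gcongr
  exact hH z

/-- The iterates `Tⁿu` stay non-negative bounded Borel. [folklore] -/
theorem ahT_iterate_closure (hτ : ReducedLawHyp τ bm bp) (hh : Measurable h) {H : ℝ}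
    (hH : ∀ z, |h z| ≤ H) (hw : 0 ≤ w) (hwH : w * H * max |bm| |bp| ≤ 1) {u : ℝ → ℝ}
    (hu : Measurable u) (hub : ∃ M, ∀ z, |u z| ≤ M) (hu0 : ∀ z, 0 ≤ u z) :
    ∀ n, Measurable ((ahT τ w h)^[n] u) ∧ (∃ M, ∀ z, |(ahT τ w h)^[n] u z| ≤ M) ∧
      ∀ z, 0 ≤ (ahT τ w h)^[n] u z
  | 0 => ⟨hu, hub, hu0⟩
  | n + 1 => by
    obtain ⟨h1, h2, h3⟩ := ahT_iterate_closure hτ hh hH hw hwH hu hub hu0 n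
    rw [Function.iterate_succ']
    exact ahT_closure hτ hh hH hw hwH h1 h2 h3

/-- The iterates `T̃ⁿu` stay non-negative bounded Borel. [folklore] -/
theorem ahTexp_iterate_closure (hτ : ReducedLawHyp τ bm bp) (hh : Measurable h) {H : ℝ}
    (hH : ∀ z, |h z| ≤ H) (w : ℝ) {u : ℝ → ℝ} (hu : Measurable u) (hub : ∃ M, ∀ z, |u z| ≤ M)
    (hu0 : ∀ z, 0 ≤ u z) :
    ∀ n, Measurable ((ahTexp τ w h)^[n] u) ∧ (∃ M, ∀ z, |(ahTexp τ w h)^[n] u z| ≤ M) ∧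
      ∀ z, 0 ≤ (ahTexp τ w h)^[n] u z
  | 0 => ⟨hu, hub, hu0⟩
  | n + 1 => by
    obtain ⟨h1, h2, h3⟩ := ahTexp_iterate_closure hτ hh hH w hu hub hu0 n
    rw [Function.iterate_succ']
    exact ahTexp_closure hτ hh hH w h1 h2 h3

/-- **(5.5), PROVED: `Tⁿu ≤ T̃ⁿu ≤ e^{2(wHb_*)² n} Tⁿu`** pointwise, for non-negative bounded
Borel `u`, `|h| ≤ H` Borel, `0 ≤ w`, `w H b_* ≤ 1/2` — so for `w²n ≤ 1` the expectation
`𝔼(e^{w∑h(X_{k-1})B_k} u(X^x_n)) = T̃ⁿu(x)` (`ahTexp_iterate_eq_integral`) and `Tⁿu(x)` agree up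
to the constant `e^{2(Hb_*)²}` ("`Tⁿu(x) ∼ 𝔼(…)`"; the paper states it for a.e. `x`, here for
every `x` on Borel representatives). [cite: AjankiHuveneers2011, §5 eq. (5.5)] -/
theorem ahT_iterate_sandwich (hτ : ReducedLawHyp τ bm bp) (hh : Measurable h) {H : ℝ}
    (hH : ∀ z, |h z| ≤ H) (hw : 0 ≤ w) (hwH : w * H * max |bm| |bp| ≤ 1 / 2) {u : ℝ → ℝ}
    (hu : Measurable u) (hub : ∃ M, ∀ z, |u z| ≤ M) (hu0 : ∀ z, 0 ≤ u z) :
    ∀ (n : ℕ) (x : ℝ), (ahT τ w h)^[n] u x ≤ (ahTexp τ w h)^[n] u x ∧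
      (ahTexp τ w h)^[n] u x ≤
        Real.exp (2 * (w * H * max |bm| |bp|) ^ 2 * n) * (ahT τ w h)^[n] u x
  | 0, x => by simp
  | n + 1, x => by
    have hwH1 : w * H * max |bm| |bp| ≤ 1 := hwH.trans (by norm_num)
    obtain ⟨m1, ⟨M1, b1⟩, p1⟩ := ahT_iterate_closure hτ hh hH hw hwH1 hu hub hu0 n
    obtain ⟨m2, ⟨M2, b2⟩, p2⟩ := ahTexp_iterate_closure hτ hh hH w hu hub hu0 n
    have ih := ahT_iterate_sandwich hτ hh hH hw hwH hu hub hu0 n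
    set c : ℝ := Real.exp (2 * (w * H * max |bm| |bp|) ^ 2 * n) with hc
    have hH0 : 0 ≤ H := (abs_nonneg _).trans (hH 0)
    have hwhx : w * |h x| * max |bm| |bp| ≤ 1 :=
      (mul_le_mul_of_nonneg_right (mul_le_mul_of_nonneg_left (hH x) hw) (by positivity)).trans hwH1
    rw [Function.iterate_succ_apply', Function.iterate_succ_apply']
    constructor
    · calc ahT τ w h ((ahT τ w h)^[n] u) x ≤ ahT τ w h ((ahTexp τ w h)^[n] u) x :=
            ahT_mono hτ m1 m2 b1 b2 (fun z => (ih z).1) hw hwhx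
        _ ≤ ahTexp τ w h ((ahTexp τ w h)^[n] u) x := ahT_le_ahTexp hτ m2 b2 p2 x
    · have hcb : ∀ z, |c * (ahT τ w h)^[n] u z| ≤ c * M1 := fun z => by
        rw [abs_mul, hc, Real.abs_exp]
        exact mul_le_mul_of_nonneg_left (b1 z) (Real.exp_pos _).le
      calc ahTexp τ w h ((ahTexp τ w h)^[n] u) x
          ≤ ahTexp τ w h (fun z => c * (ahT τ w h)^[n] u z) x :=
            ahTexp_mono hτ m2 (measurable_const.mul m1) b2 hcb (fun z => (ih z).2) x
        _ = c * ahTexp τ w h ((ahT τ w h)^[n] u) x := ahTexp_const_mul τ w h c _ x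
        _ ≤ c * (Real.exp (2 * (w * H * max |bm| |bp|) ^ 2) * ahT τ w h ((ahT τ w h)^[n] u) x) :=
            mul_le_mul_of_nonneg_left (ahTexp_le_ahT hτ m1 b1 p1 hw hH hwH x) (Real.exp_pos _).le
        _ = Real.exp (2 * (w * H * max |bm| |bp|) ^ 2 * (n + 1 : ℕ)) *
              ahT τ w h ((ahT τ w h)^[n] u) x := by
            rw [hc, ← mul_assoc, ← Real.exp_add]
            push_cast
            ring_nf

end Comparison

end Literature.Barriers.AtomisticToContinuum.HeatConduction

namespace Literature.Barriers.AtomisticToContinuum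

open Literature.MathematicalPhysics.KineticTheory.HeatConduction HeatConduction

/-! ### Named facts: Lemmas 5.2–5.5 -/

/-- **Lemma 5.2 (approximate kernels), eqs. (5.9)–(5.10)**: "Let `ε > 0`. There exists `K > 0` such
that, for every `n ∈ ℕ` satisfying `8 ≤ n ≤ w⁻²`, for every `y ∈ 𝕋 - B(0,ε)`, and for every
`u ∈ L¹_{B(y,w²)}(𝕋; ℝ₊)`, one has `S_{y,n}u ∈ C²(𝕋)` and, for every `x ∈ 𝕋`,
`|∂ˡ_x S_{y,n}u(x)| ≤ K‖u‖₁/(w√n)^{l+1}`, `l = 0,1,2`, and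
`|sinᵏ π(x + wn - y) · ∂ᵏ_x S_{y,n}u(x)| ≤ K‖u‖₁/(w√n)`, `k = 1,2`" (for `w ∈ (0, w₀]`, `w₀` and
`K` depending on `ε`, `h`, `τ`; proof: Appendix 7.3, the `T_{y-kw}` being diagonal in Fourier
space). `u` ranges over bounded Borel representatives (`AHBallFn u y (w²)`, module docstring).
[cite: AjankiHuveneers2011, Lemma 5.2 eqs. (5.9)-(5.10)] -/
def AjankiHuveneers2011_approxKernels : Prop :=
  ∀ (τ : ℝ → ℝ) (bm bp : ℝ), ReducedLawHyp τ bm bp →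
    ∀ h : ℝ → ℝ, Function.Periodic h 1 → ContDiff ℝ 1 h → ∀ ε : ℝ, 0 < ε →
      ∃ w₀ : ℝ, 0 < w₀ ∧ ∃ K : ℝ, 0 < K ∧ ∀ w ∈ Set.Ioc 0 w₀, ∀ n : ℕ, 8 ≤ n → w ^ 2 * n ≤ 1 →
        ∀ y : ℝ, (∀ k : ℤ, ε ≤ |y - k|) → ∀ u : ℝ → ℝ, AHBallFn u y (w ^ 2) →
          ContDiff ℝ 2 (ahSy τ w h y n u) ∧
          ∀ x : ℝ,
            |ahSy τ w h y n u x| ≤ K * ahL1 u / (w * Real.sqrt n) ∧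
            |deriv (ahSy τ w h y n u) x| ≤ K * ahL1 u / (w * Real.sqrt n) ^ 2 ∧
            |iteratedDeriv 2 (ahSy τ w h y n u) x| ≤ K * ahL1 u / (w * Real.sqrt n) ^ 3 ∧
            |Real.sin (π * (x + w * n - y)) * deriv (ahSy τ w h y n u) x| ≤
              K * ahL1 u / (w * Real.sqrt n) ∧
            |Real.sin (π * (x + w * n - y)) ^ 2 * iteratedDeriv 2 (ahSy τ w h y n u) x| ≤
              K * ahL1 u / (w * Real.sqrt n)

/-- **Lemma 5.2 (approximate kernels), eq. (5.11), the lower bound**: "Moreover, when `ε` is small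
enough, there exists `K'(ε) > 0`, with `K'(ε) → ∞` as `ε → 0`, such that, for every `n ∈ ℕ`
satisfying `ε ≤ w²n ≤ 2ε`, for every `x, y ∈ 𝕋`, and for every `u ∈ L¹_{B(y,w²)}(𝕋; ℝ₊)`,
`S_{y,n}u(x) ≥ K'(ε)‖u‖₁` when `|x + nw - y|_𝕋 ≤ 10ε`." Rendered with `K'(ε) → ∞` as: for every
target constant `A` there is `ε₀ > 0` such that for all `ε ∈ (0, ε₀]` (and then `w ≤ w₀(ε)`) the
bound holds with constant `A`. [cite: AjankiHuveneers2011, Lemma 5.2 eq. (5.11)] -/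
def AjankiHuveneers2011_approxKernelsLower : Prop :=
  ∀ (τ : ℝ → ℝ) (bm bp : ℝ), ReducedLawHyp τ bm bp →
    ∀ h : ℝ → ℝ, Function.Periodic h 1 → ContDiff ℝ 1 h → ∀ A : ℝ,
      ∃ ε₀ : ℝ, 0 < ε₀ ∧ ∀ ε ∈ Set.Ioc 0 ε₀, ∃ w₀ : ℝ, 0 < w₀ ∧ ∀ w ∈ Set.Ioc 0 w₀,
        ∀ n : ℕ, ε ≤ w ^ 2 * n → w ^ 2 * n ≤ 2 * ε → ∀ x y : ℝ, ∀ u : ℝ → ℝ, AHBallFn u y (w ^ 2) →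
          (∃ k : ℤ, |x + n * w - y - k| ≤ 10 * ε) → A * ahL1 u ≤ ahSy τ w h y n u x

/-- **Lemma 5.3 (estimates on `R_y`), eq. (5.12) — DEPRECATED record: REFUTED as printed, RESTATED
(corrected) as `AjankiHuveneers2011_RyEstimateCorrected`.** The statement below is kept byte-for-byte
only because its refutation names it; it is not a named fact of the tree any more and must never be
used as a hypothesis (it yields `False`).

The printed lemma: "There exists `K > 0` such that, for every `u ∈ C²(𝕋)` and every `y ∈ 𝕋`, one
has `‖R_y u‖_∞ ≤ K w² {‖sin π(· - y - w) · u'‖_∞ + w‖u'‖_∞ + ‖sin² π(· - y - w) · u''‖_∞ + w‖u''‖_∞}`"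
(for `w ∈ (0, w₀]`; `K`, `w₀` depending on `h`, `τ`; printed proof: the mean value theorem,
`|φ(x) - φ(y)|, |ψ(x) - ψ(y)|, |h(x) - h(y)| ≲ |sin π(x-y)|` and `∫ b τ(b) db = 0`). The four
sup-norms are rendered by arbitrary majorants `A₁, A₁', A₂, A₂'`.

**What was wrong (verdict 2026-08-15, re-verified 2026-08-16 against arXiv:1003.1076, p. 15,
Lemma 5.3 / (5.12)–(5.13)).** The transcription is faithful; the printed statement is false. Its
negation `AjankiHuveneers2011_RyEstimate_false : ¬ AjankiHuveneers2011_RyEstimate` is proved in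
`DisorderedHarmonicChainRyCounterexample.lean` (`h = 0`, `τ` uniform on `[-1/2, 1/2]`, `y = 1/4`,
`x = y + 1/m`, `u = cos^{4m²+2}(π(· - x - ϑ))`, `w ≤ m⁻²` small: `-R_y u(x) ≥ (π²/12) m w² - O(w²)`
while the printed right-hand side is `≤ 51000 K w²` — absurd for `m` large). The slip is (5.13)
of the printed proof: the mean-value point lies between `f_b(x)` and `g_b(x,y)`, both
`x + w + O(w)`, so `|ξ₁| = O(w)` (not `w|φ(x) - φ(y)| + O(w²)`) and the cross term
`w² |sin π(x-y)| |u''|` keeps ONE power of the sine.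

**The restatement.** The corrected lemma — `‖sin π(· - y - w) · u''‖_∞` in place of
`‖sin² π(· - y - w) · u''‖_∞`, everything else verbatim — is
`AjankiHuveneers2011_RyEstimateCorrected` in `DisorderedHarmonicChainRyEstimate.lean`, PROVED there
(`AjankiHuveneers2011_RyEstimateCorrected_holds`) together with
`AjankiHuveneers2011_RyEstimate.corrected` (printed ⟹ corrected, since `sin² ≤ |sin|`). It is not
re-declared here because that file imports this one (the name would be declared twice), which is
also why the `deprecated` attribute below carries a message and not the replacement identifier.
Consumers (the Prop. 5.1 assembly, Step 1) must use the corrected lemma, at the price of a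
`log w⁻¹` unless extra cancellation is found.
[cite: AjankiHuveneers2011, Lemma 5.3 eq. (5.12) — false as printed, see the deprecation note; corrected as AjankiHuveneers2011_RyEstimateCorrected] -/
@[deprecated "refuted as printed (Ajanki–Huveneers 2011, Lemma 5.3 eq. (5.12)): see \
  Literature.Barriers.AtomisticToContinuum.AjankiHuveneers2011_RyEstimate_false \
  (DisorderedHarmonicChainRyCounterexample.lean); corrected statement (sin for sin² on the u'' term): \
  Literature.Barriers.AtomisticToContinuum.AjankiHuveneers2011_RyEstimateCorrected, proved as \
  AjankiHuveneers2011_RyEstimateCorrected_holds (DisorderedHarmonicChainRyEstimate.lean)" (since := "2026-08-16")]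
def AjankiHuveneers2011_RyEstimate : Prop :=
  ∀ (τ : ℝ → ℝ) (bm bp : ℝ), ReducedLawHyp τ bm bp →
    ∀ h : ℝ → ℝ, Function.Periodic h 1 → ContDiff ℝ 1 h →
      ∃ w₀ : ℝ, 0 < w₀ ∧ ∃ K : ℝ, 0 < K ∧ ∀ w ∈ Set.Ioc 0 w₀,
        ∀ u : ℝ → ℝ, Function.Periodic u 1 → ContDiff ℝ 2 u → ∀ y : ℝ, ∀ A₁ A₁' A₂ A₂' : ℝ,
          (∀ z, |Real.sin (π * (z - y - w)) * deriv u z| ≤ A₁) → (∀ z, |deriv u z| ≤ A₁') →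
          (∀ z, |Real.sin (π * (z - y - w)) ^ 2 * iteratedDeriv 2 u z| ≤ A₂) →
          (∀ z, |iteratedDeriv 2 u z| ≤ A₂') →
            ∀ x, |ahRy τ w h y u x| ≤ K * w ^ 2 * (A₁ + w * A₁' + A₂ + w * A₂')

/-- **Lemma 5.4 (`L¹` estimates on `R_y` and `T`), eqs. (5.14)–(5.15)**: "Let `K, ε > 0`. Let `y ∈ 𝕋`
be such that `|y|_𝕋 ≥ ε`. Then there exists `K' > 0` such that, for every `u ∈ L¹_{B(y,Kw)}(𝕋)`,
one has `‖R_y u‖₁ ≤ K' w ‖u‖₁`. Moreover `Tu ∈ L^∞(𝕋)`, and one has `‖Tu‖_∞ ≤ K' w⁻¹ ‖u‖₁`"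
("the constants introduced in this proof may depend on `K` and `ε`" — not on `y` or `w ≤ w₀`;
proof: the kernels `t(x,z)`, `t_y(x,z)` of `T`, `T_y` obtained by the change of variables
`b ↦ f_b(x)`, `∂_b f_b(x) ≳ w` for `|y|_𝕋 ≥ ε`). `u` ranges over bounded Borel non-negative
representatives (`AHBallFn u y (Kw)`). [cite: AjankiHuveneers2011, Lemma 5.4 eqs. (5.14)-(5.15)] -/
def AjankiHuveneers2011_RyL1Estimate : Prop :=
  ∀ (τ : ℝ → ℝ) (bm bp : ℝ), ReducedLawHyp τ bm bp →
    ∀ h : ℝ → ℝ, Function.Periodic h 1 → ContDiff ℝ 1 h → ∀ K : ℝ, 0 < K → ∀ ε : ℝ, 0 < ε →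
      ∃ w₀ : ℝ, 0 < w₀ ∧ ∃ K' : ℝ, 0 < K' ∧ ∀ w ∈ Set.Ioc 0 w₀,
        ∀ y : ℝ, (∀ k : ℤ, ε ≤ |y - k|) → ∀ u : ℝ → ℝ, AHBallFn u y (K * w) →
          ahL1 (ahRy τ w h y u) ≤ K' * w * ahL1 u ∧ ∀ x, |ahT τ w h u x| ≤ K' * w⁻¹ * ahL1 u

/-- **Lemma 5.5 (localization), eq. (5.20), concentration of `Tⁿu`**: "for every `R > 0` large
enough, there exists `K' > 0` such that, for every `n ∈ ℕ` satisfying `wn ≤ 1`, for every `y ∈ 𝕋`,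
and for every `u ∈ L¹_{B(y,w)}(𝕋; ℝ₊)`, one has `∫_{B(y-nw, R√w)} Tⁿu(z) dz ≥ K'‖u‖₁`" (for
`w ∈ (0, w₀]`, `w₀ ≤ w₀(R)` so small that `R√w < 1/2` and the ball is an arc, integrated here over
its lift `(y - nw - R√w, y - nw + R√w)`; proof: the adjoint `T*`, the reversed chain
`Y^z_n = f_{B_n}^{-1}(Y^z_{n-1})` and Azuma's inequality). `u` ranges over bounded Borel
representatives. [cite: AjankiHuveneers2011, Lemma 5.5 eq. (5.20)] -/
def AjankiHuveneers2011_concentration : Prop :=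
  ∀ (τ : ℝ → ℝ) (bm bp : ℝ), ReducedLawHyp τ bm bp →
    ∀ h : ℝ → ℝ, Function.Periodic h 1 → ContDiff ℝ 1 h →
      ∃ R₀ : ℝ, 0 < R₀ ∧ ∀ R : ℝ, R₀ ≤ R → ∃ w₀ : ℝ, 0 < w₀ ∧ ∃ K' : ℝ, 0 < K' ∧
        ∀ w ∈ Set.Ioc 0 w₀, ∀ n : ℕ, w * n ≤ 1 → ∀ y : ℝ, ∀ u : ℝ → ℝ, AHBallFn u y w →
          K' * ahL1 u ≤ ∫ z in Set.Ioo (y - n * w - R * Real.sqrt w) (y - n * w + R * Real.sqrt w),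
            (ahT τ w h)^[n] u z

end Literature.Barriers.AtomisticToContinuum

end
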